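import Mathlib
import Literature.NumberTheory.LFunctions.Zhang2022.Section7Eq719
import Literature.NumberTheory.LFunctions.Zhang2022.Section7dZetaZeroFree
import Literature.NumberTheory.LFunctions.Zhang2022.Section7KappaLocalBounds
import Literature.NumberTheory.LFunctions.Zhang2022.Section7Residue
import Literature.NumberTheory.LFunctions.ZetaZerosProofs
import Literature.Analysis.Complex.VerticalLineShift
import Literature.Analysis.Complex.RectangleResidueSimplePoles
import HarnessLib

/-!
# Zhang (2022) §7 p. 40, node `Z22:§7.u047`: the contour move in (7.19) — DISCHARGED

Topic `Literature/NumberTheory/LFunctions/Zhang2022` (Landau–Siegel adjudication tree;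
verdict-neutral). Y. Zhang, *Discrete mean estimates and the Landau–Siegel zero*,
arXiv:2211.02515v1 (2022) [Zhang2022LandauSiegel], §7 "Proof of Proposition 7.1: the main term",
PDF p. 40, tex L2108–L2117 (DAG nodes `Z22:§7.u047`, `Z22:§7.u048`):

> By the simple bounds … for `σ > 9/10`, we can move the contour of integration in (7.19) to the
> vertical segments `s = 1 + α + it` with `|t| ≥ D`, `s = 1 − 𝓛⁻¹ + it` with `|t| ≤ D`
> and to the two connecting horizontal segments `s = σ ± iD` with `1 − 𝓛⁻¹ ≤ σ ≤ 1 + α`.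

The typed node `Section7dStatements.Step7u047 c′` (slice L2-t5) states the resulting IDENTITY:
`mellinInv (3/2) (κ̃λ·resFn) (l₂/(pk)) = contour719 D (x^{−s}κ̃λ·resFn) + Σ_{j≤3} 𝔯ⱼκ̃₀ⱼλ₀ⱼx^{−(1−β_j)}`
(`resFn = ζ(s+β₁)ζ(s+β₂)ζ(s+β₃)ζ(s)⁻¹δ(s)`, the residues `𝔯ⱼ = frakr` of `Z22:§7.u050`, the contour
`contour719 = vert747 + horiz748`). This file PROVES it (`step7u047_holds`), for all large `D`
under (A) — Assumption (A) is used exactly once, through the tree's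
`zeta_ne_zero_of_assumptionA` (`ζ(s) ≠ 0` for `σ ≥ 1 − 𝓛⁻¹`, `|t| ≤ D`; the presupposition recorded
in the docstring of `Step7u047` and in the campaign's gap ledger, row G-adj2-3):

1. **Regularised integrand.** The literal integrand uses Mathlib's junk value of `ζ(1)`; we work
   with `Fr(s) = x^{−s}κ̃(s)λ(s)ζ(s+β₁)ζ(s+β₂)ζ(s+β₃)·ι(s)·δ(s)`, `ι = update (ζ⁻¹) 1 0`
   (`= (s−1)/η(s)` with `η(s) = (s−1)ζ(s)`, `η(1) = 1`, analytic at `1`: tree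
   `analyticAt_update_sub_one_mul_riemannZeta`), which agrees with the printed one off `s = 1`,
   hence on every contour, and is holomorphic on `U = {σ > 19/20, s = 1 ∨ ζ(s) ≠ 0}` minus the three
   simple poles `1 − β_j` (`differentiableAt_integrand`; `κ̃` holomorphic on `σ > 19/20` as a locally
   uniform limit, majorant `τ₄(d₁)Σ_{h∈𝔫(d₁)}τ₄(h)h^{−19/20}` via the Euler product over
   `Nat.factoredNumbers` — adapted from `Section7KappaBounds`; `λ` a finite product; `δ` holomorphic
   on `σ > 0`, tree `Lemma53.differentiableOn_delta514`).
2. **Poles.** `ζ(z+β_j) = η(z+β_j)/(z − (1−β_j))`, so `Fr = φ_j/(z − (1−β_j))` near `1 − β_j` with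
   `φ_j` differentiable and `φ_j(1−β_j) = 𝔯ⱼκ̃₀ⱼλ₀ⱼx^{−(1−β_j)}` (`pole_one/two/three`,
   `residue_sum_eq`; the `β_j = ib_j` are non-zero and pairwise distinct for large `D`, tree
   `Residue750.b_chain`).
3. **Shift `σ = 3/2 → σ = 1 + α`** (no poles: tree `integral_vertical_eq_of_differentiableOn`), with
   absolute integrability and decay from `|Fr(σ+it)| ≤ C₀(1+t²)⁻¹` on `1+α ≤ σ ≤ 3/2`
   (`|δ(s)| ≤ K/|s|²`, tree `Lemma53.norm_delta514_le`; `ζ`, `ζ⁻¹ = Σμ(n)n^{−s}`, `κ̃`, `λ` bounded).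
4. **Rectangle `[1−𝓛⁻¹, 1+α] × [−D, D]`** with the three simple poles inside (tree
   `rectBoundaryIntegral_eq_sum_of_simplePoles`), inside `U` by `zeta_ne_zero_of_assumptionA`;
   splitting the line `σ = 1+α` at `±D` and bookkeeping.

No new definitions, no named facts, no `sorry`. WHAT THIS IS NOT: the bound `O(pkε₁/l₂)` for the
shifted contour (`Z22:§7.u049`, whose typed uniformity is under discussion, gap row G-d24-1), or any
claim about Theorems 1–2 of the source or about Landau–Siegel zeros.

## References

* Y. Zhang, arXiv:2211.02515v1 (2022), §7 p. 40, tex L2108–L2117; (7.19); §5 (5.14).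
  [cite: Zhang2022LandauSiegel, §7 p.40]
* J. B. Conway, *Functions of One Complex Variable I*, 2nd ed. (1978), Ch. V Thm. 2.2 (residue
  theorem; the tree's `RectangleResidueSimplePoles`). [cite: Conway1978, Ch. V Thm. 2.2]
-/

noncomputable section

open Complex Real MeasureTheory Set Filter Topology

namespace Literature.NumberTheory.LFunctions.Zhang2022.Section7dStatements

/-- `𝓛₂ ≥ 1` for `D ≥ 3`. [cite: Zhang2022LandauSiegel, §2 (2.15)] -/
private theorem one_le_ell2 {D : ℕ} (hD : 3 ≤ D) : 1 ≤ Skeleton.ell2 D := by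
  have hD' : (3 : ℝ) ≤ D := by exact_mod_cast hD
  have h1 : (1 : ℝ) < Real.log 3 := by
    rw [Real.lt_log_iff_exp_lt (by norm_num)]
    exact Real.exp_one_lt_d9.trans (by norm_num)
  have hℓ : 1 ≤ Skeleton.ell D := le_trans h1.le (Real.log_le_log (by norm_num) hD')
  exact one_le_pow₀ hℓ

/-! ## §A. The regularised reciprocal `ζ(s)⁻¹` and the simple pole of `ζ` -/

/-- `η(1) = 1` for the regularised `η(s) = (s − 1)ζ(s)`. [folklore] -/
private theorem eta_one :
    Function.update (fun s : ℂ => (s - 1) * riemannZeta s) 1 1 1 = 1 :=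
  Function.update_self ..

/-- `η(w) = (w − 1)ζ(w)` for `w ≠ 1`. [folklore] -/
private theorem eta_of_ne {w : ℂ} (hw : w ≠ 1) :
    Function.update (fun s : ℂ => (s - 1) * riemannZeta s) 1 1 w = (w - 1) * riemannZeta w :=
  Function.update_of_ne hw ..

/-- The regularised reciprocal: `𝟙[w ≠ 1]ζ(w)⁻¹ = (w − 1)/η(w)` for EVERY `w` (both sides vanish at
`w = 1`; Lean's `x/0 = 0` makes the identity total). [folklore] -/
private theorem zetaInvReg_eq_div_eta (w : ℂ) :
    Function.update (fun z : ℂ => (riemannZeta z)⁻¹) 1 0 w =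
      (w - 1) / Function.update (fun s : ℂ => (s - 1) * riemannZeta s) 1 1 w := by
  by_cases hw : w = 1
  · subst hw
    rw [Function.update_self, eta_one, sub_self, zero_div]
  · rw [Function.update_of_ne hw, eta_of_ne hw, div_mul_cancel_left₀ (sub_ne_zero.mpr hw)]

/-- Away from `1`, the regularised reciprocal is `ζ(w)⁻¹`. [folklore] -/
private theorem zetaInvReg_of_ne {w : ℂ} (hw : w ≠ 1) :
    Function.update (fun z : ℂ => (riemannZeta z)⁻¹) 1 0 w = (riemannZeta w)⁻¹ :=
  Function.update_of_ne hw ..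

/-- `η` is differentiable on an open ball around `1` (it is analytic at `1`, tree
`analyticAt_update_sub_one_mul_riemannZeta`) and does not vanish there. [folklore] -/
private theorem exists_ball_eta_differentiableOn :
    ∃ ε : ℝ, 0 < ε ∧
      DifferentiableOn ℂ (Function.update (fun s : ℂ => (s - 1) * riemannZeta s) 1 1)
        (Metric.ball 1 ε) ∧
      ∀ w ∈ Metric.ball (1 : ℂ) ε,
        Function.update (fun s : ℂ => (s - 1) * riemannZeta s) 1 1 w ≠ 0 := by
  have hη := Literature.NumberTheory.LFunctions.analyticAt_update_sub_one_mul_riemannZeta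
  have h1 : ∀ᶠ w in 𝓝 (1 : ℂ),
      AnalyticAt ℂ (Function.update (fun s : ℂ => (s - 1) * riemannZeta s) 1 1) w :=
    hη.eventually_analyticAt
  have h2 : ∀ᶠ w in 𝓝 (1 : ℂ),
      Function.update (fun s : ℂ => (s - 1) * riemannZeta s) 1 1 w ≠ 0 := by
    have hc := hη.continuousAt
    have : Function.update (fun s : ℂ => (s - 1) * riemannZeta s) 1 1 1 ≠ 0 := by
      rw [eta_one]; exact one_ne_zero
    exact hc.eventually_ne this
  obtain ⟨ε, hε, h⟩ := Metric.eventually_nhds_iff_ball.mp (h1.and h2)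
  exact ⟨ε, hε, fun w hw => (h w hw).1.differentiableAt.differentiableWithinAt,
    fun w hw => (h w hw).2⟩

/-- The regularised reciprocal is differentiable at `1` (`= (w−1)/η(w)`, `η(1) = 1 ≠ 0`).
[folklore] -/
private theorem differentiableAt_zetaInvReg_one :
    DifferentiableAt ℂ (Function.update (fun z : ℂ => (riemannZeta z)⁻¹) 1 0) 1 := by
  have hfun : Function.update (fun z : ℂ => (riemannZeta z)⁻¹) 1 0 =
      fun w => (w - 1) / Function.update (fun s : ℂ => (s - 1) * riemannZeta s) 1 1 w :=
    funext zetaInvReg_eq_div_eta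
  rw [hfun]
  have hη := Literature.NumberTheory.LFunctions.analyticAt_update_sub_one_mul_riemannZeta
  refine (differentiableAt_id.sub_const 1).div hη.differentiableAt ?_
  rw [eta_one]; exact one_ne_zero

/-- The regularised reciprocal is differentiable at every `z ≠ 1` with `ζ(z) ≠ 0`. [folklore] -/
private theorem differentiableAt_zetaInvReg {z : ℂ} (hz : z ≠ 1) (hζ : riemannZeta z ≠ 0) :
    DifferentiableAt ℂ (Function.update (fun z : ℂ => (riemannZeta z)⁻¹) 1 0) z := by
  have hev : Function.update (fun z : ℂ => (riemannZeta z)⁻¹) 1 0 =ᶠ[𝓝 z]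
      fun w => (riemannZeta w)⁻¹ := by
    filter_upwards [isOpen_ne.mem_nhds hz] with w hw
    exact Function.update_of_ne hw ..
  exact ((differentiableAt_riemannZeta hz).inv hζ).congr_of_eventuallyEq hev

/-- The regularised reciprocal is differentiable at every point of `{z | z = 1 ∨ ζ(z) ≠ 0}`.
[folklore] -/
private theorem differentiableAt_zetaInvReg' {z : ℂ} (hz : z = 1 ∨ riemannZeta z ≠ 0) :
    DifferentiableAt ℂ (Function.update (fun z : ℂ => (riemannZeta z)⁻¹) 1 0) z := by
  by_cases h1 : z = 1
  · subst h1; exact differentiableAt_zetaInvReg_one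
  · exact differentiableAt_zetaInvReg h1 (hz.resolve_left h1)

/-- **The simple pole of `ζ(z + β)` at `z = 1 − β`**: `ζ(z+β) = η(z+β)/(z − (1−β))` for
`z ≠ 1 − β`. [folklore] -/
private theorem zeta_shift_eq_eta_div {β z : ℂ} (hz : z ≠ 1 - β) :
    riemannZeta (z + β) =
      Function.update (fun s : ℂ => (s - 1) * riemannZeta s) 1 1 (z + β) / (z - (1 - β)) := by
  have hne : z + β ≠ 1 := fun h => hz (by rw [← h]; ring)
  have hne' : z - (1 - β) ≠ 0 := sub_ne_zero.mpr hz
  rw [eta_of_ne hne, show z + β - 1 = z - (1 - β) by ring, eq_div_iff hne']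
  ring

/-! ## §B. Holomorphy and bounds of the factors `κ̃`, `λ`, `ζ`, `ζ⁻¹` -/

section KappaTilde

open ArithmeticFunction

/-- `((q^e) : ℝ)^{−σ} = (q^{−σ})^e`. [folklore] -/
private theorem rpow_natPow_neg' (q e : ℕ) (σ : ℝ) :
    (((q ^ e : ℕ) : ℝ)) ^ (-σ) = ((q : ℝ) ^ (-σ)) ^ e := by
  rw [Nat.cast_pow, ← Real.rpow_natCast, ← Real.rpow_mul (Nat.cast_nonneg q), mul_comm,
    Real.rpow_mul (Nat.cast_nonneg q), Real.rpow_natCast]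

/-- Euler product of the majorant `Σ_{h ∈ 𝔫(d)} τ₄(h) h^{−σ} = ∏_{q∣d}(1 − q^{−σ})^{−4}`, `σ > 9/10`
(adapted from `Section7KappaBounds`, where it is private). [folklore] -/
private theorem hasSum_tau4_rpow' {σ : ℝ} (hσ : 9 / 10 < σ) (d : ℕ) :
    HasSum ((Nat.factoredNumbers d.primeFactors).indicator fun h : ℕ =>
        (((ArithmeticFunction.zeta ^ 4 : ArithmeticFunction ℕ) h : ℕ) : ℝ) * (h : ℝ) ^ (-σ))
      (∏ q ∈ d.primeFactors, 1 / (1 - (q : ℝ) ^ (-σ)) ^ 4) := by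
  set F : ℕ → ℝ := fun h =>
    (((ArithmeticFunction.zeta ^ 4 : ArithmeticFunction ℕ) h : ℕ) : ℝ) * (h : ℝ) ^ (-σ) with hF
  have hF1 : F 1 = 1 := by
    simp only [hF, (ArithmeticFunction.isMultiplicative_zeta.pow (k := 4)).map_one, Nat.cast_one,
      Real.one_rpow, mul_one]
  have hmul : ∀ {a b : ℕ}, Nat.Coprime a b → F (a * b) = F a * F b := fun {a b} hab => by
    simp only [hF]
    rw [(ArithmeticFunction.isMultiplicative_zeta.pow (k := 4)).map_mul_of_coprime hab, Nat.cast_mul,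
      Nat.cast_mul, Real.mul_rpow (Nat.cast_nonneg a) (Nat.cast_nonneg b)]
    ring
  have hloc : ∀ {q : ℕ}, q.Prime → ∀ e : ℕ,
      F (q ^ e) = (((e + 3).choose 3 : ℕ) : ℝ) * ((q : ℝ) ^ (-σ)) ^ e := fun {q} hq e => by
    simp only [hF]
    rw [show (4 : ℕ) = 3 + 1 from rfl, KappaBounds.zeta_pow_succ_prime_pow hq 3,
      rpow_natPow_neg']
  have hx : ∀ {q : ℕ}, q.Prime → ‖(q : ℝ) ^ (-σ)‖ < 1 := fun {q} hq => by
    obtain ⟨h0, h1⟩ := KappaBounds.rpow_neg_range hq hσ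
    rw [Real.norm_of_nonneg h0.le]; linarith
  have hsum : ∀ {q : ℕ}, q.Prime → Summable fun e : ℕ => ‖F (q ^ e)‖ := fun {q} hq => by
    have := (summable_choose_mul_geometric_of_norm_lt_one 3 (hx hq)).norm
    refine this.congr fun e => ?_
    rw [hloc hq]
  have key := (EulerProduct.summable_and_hasSum_factoredNumbers_prod_filter_prime_tsum hF1 hmul
    hsum d.primeFactors).2
  have hfilter : d.primeFactors.filter Nat.Prime = d.primeFactors :=
    Finset.filter_true_of_mem fun q hq => Nat.prime_of_mem_primeFactors hq
  have hprod : (∏ q ∈ d.primeFactors, ∑' e : ℕ, F (q ^ e)) =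
      ∏ q ∈ d.primeFactors, 1 / (1 - (q : ℝ) ^ (-σ)) ^ 4 := by
    refine Finset.prod_congr rfl fun q hq => ?_
    have hq' := Nat.prime_of_mem_primeFactors hq
    rw [tsum_congr (hloc hq'), tsum_choose_mul_geometric_of_norm_lt_one 3 (hx hq')]
  rw [hfilter, hprod] at key
  exact hasSum_subtype_iff_indicator.mp key

variable (c' : ℝ) (D : ℕ)

open scoped Classical in
/-- **A uniform majorant for the terms of `κ̃(d₁;m,s)` on `σ > 19/20`**: summable `u` with
`‖𝟙[h ∈ 𝔫(d₁),(h,m)=1] κ(d₁h)h^{−s}‖ ≤ u(h)` (`|κ(d₁h)| ≤ τ₄(d₁)τ₄(h)`, `|h^{−s}| ≤ h^{−19/20}`).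
[cite: Zhang2022LandauSiegel, §7 p.40, tex L2105] -/
theorem exists_kappaTilde_majorant {d₁ : ℕ} (hd₁ : d₁ ≠ 0) (m : ℕ) :
    ∃ u : ℕ → ℝ, Summable u ∧ (∀ h, 0 ≤ u h) ∧ ∀ (h : ℕ) (s : ℂ), 19 / 20 < s.re →
      ‖(if h ∈ Skeleton.nset d₁ ∧ Nat.Coprime h m then
          Skeleton.kappaZ c' D (d₁ * h) / (h : ℂ) ^ s else 0)‖ ≤ u h := by
  set S := d₁.primeFactors with hS
  set T4 : ℕ → ℕ := fun n => (ArithmeticFunction.zeta ^ 4 : ArithmeticFunction ℕ) n with hT4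
  set G : ℕ → ℝ := fun h => ((T4 h : ℕ) : ℝ) * (h : ℝ) ^ (-(19 / 20 : ℝ)) with hG
  have hsumG := hasSum_tau4_rpow' (σ := 19 / 20) (by norm_num) d₁
  set u : ℕ → ℝ := fun h => ((T4 d₁ : ℕ) : ℝ) * (Nat.factoredNumbers S).indicator G h with hu
  have hG0 : ∀ h, 0 ≤ G h := fun h => by positivity
  have hu0 : ∀ h, 0 ≤ u h := fun h =>
    mul_nonneg (Nat.cast_nonneg _) (Set.indicator_nonneg (fun _ _ => hG0 _) _)
  refine ⟨u, (hsumG.mul_left _).summable, hu0, fun h s hs => ?_⟩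
  by_cases hh : h ∈ Skeleton.nset d₁ ∧ Nat.Coprime h m
  · have h0 : h ≠ 0 := hh.1.1.ne'
    have hmem : h ∈ Nat.factoredNumbers S :=
      Nat.mem_factoredNumbers_iff_primeFactors_subset.mpr ⟨h0, fun q hq => by
        have hq' := Nat.mem_primeFactors.mp hq
        exact Nat.mem_primeFactors.mpr ⟨hq'.1, hh.1.2 q hq'.1 hq'.2.1, hd₁⟩⟩
    rw [if_pos hh]
    simp only [hu, Set.indicator_of_mem hmem, hG]
    rw [norm_div, Complex.norm_natCast_cpow_of_pos (Nat.pos_of_ne_zero h0), div_eq_mul_inv,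
      ← Real.rpow_neg (Nat.cast_nonneg h), ← mul_assoc]
    have hh1 : (1 : ℝ) ≤ h := by exact_mod_cast Nat.pos_of_ne_zero h0
    have hexp : (h : ℝ) ^ (-s.re) ≤ (h : ℝ) ^ (-(19 / 20 : ℝ)) :=
      Real.rpow_le_rpow_of_exponent_le hh1 (by linarith)
    refine mul_le_mul ?_ hexp (by positivity) (by positivity)
    calc ‖Skeleton.kappaZ c' D (d₁ * h)‖ ≤ ((T4 (d₁ * h) : ℕ) : ℝ) :=
          KappaBounds.norm_kappa_le_tau4 _ _ _ (mul_ne_zero hd₁ h0)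
      _ ≤ ((T4 d₁ * T4 h : ℕ) : ℝ) := by exact_mod_cast KappaBounds.tau4_mul_le hd₁ h0
      _ = ((T4 d₁ : ℕ) : ℝ) * ((T4 h : ℕ) : ℝ) := Nat.cast_mul _ _
  · rw [if_neg hh, norm_zero]
    exact hu0 h

open scoped Classical in
/-- **`κ̃(d₁;m,·)` is holomorphic on `σ > 19/20`** (locally uniform limit of its partial sums).
[cite: Zhang2022LandauSiegel, §7 p.40] -/
theorem differentiableOn_kappaTilde {d₁ : ℕ} (hd₁ : d₁ ≠ 0) (m : ℕ) :
    DifferentiableOn ℂ (Skeleton.kappaTilde c' D d₁ m) {s : ℂ | 19 / 20 < s.re} := by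
  obtain ⟨u, hu, -, hle⟩ := exists_kappaTilde_majorant c' D hd₁ m
  have hopen : IsOpen {s : ℂ | 19 / 20 < s.re} :=
    isOpen_lt continuous_const Complex.continuous_re
  have h := differentiableOn_tsum_of_summable_norm (U := {s : ℂ | 19 / 20 < s.re})
    (F := fun (h : ℕ) (s : ℂ) => if h ∈ Skeleton.nset d₁ ∧ Nat.Coprime h m then
      Skeleton.kappaZ c' D (d₁ * h) / (h : ℂ) ^ s else 0) hu ?_ hopen ?_
  · refine h.congr fun s _ => ?_
    simp only [Skeleton.kappaTilde]
  · intro h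
    by_cases hh : h ∈ Skeleton.nset d₁ ∧ Nat.Coprime h m
    · simp only [if_pos hh]
      intro s _
      have h0 : (h : ℂ) ≠ 0 := Nat.cast_ne_zero.mpr hh.1.1.ne'
      have hne : (h : ℂ) ^ s ≠ 0 := fun hz => h0 ((cpow_eq_zero_iff _ _).mp hz).1
      exact ((differentiableAt_const _).div (differentiableAt_id.const_cpow (Or.inl h0))
        hne).differentiableWithinAt
    · simp only [if_neg hh]
      exact differentiableOn_const _
  · intro h s hs
    exact hle h s hs

open scoped Classical in
/-- **`κ̃(d₁;m,·)` is bounded on `σ > 19/20`**: `‖κ̃‖ ≤ Σ u`. [cite: Zhang2022LandauSiegel, §7 p.40] -/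
theorem exists_norm_kappaTilde_le {d₁ : ℕ} (hd₁ : d₁ ≠ 0) (m : ℕ) :
    ∃ K : ℝ, 0 ≤ K ∧ ∀ s : ℂ, 19 / 20 < s.re → ‖Skeleton.kappaTilde c' D d₁ m s‖ ≤ K := by
  obtain ⟨u, hu, hu0, hle⟩ := exists_kappaTilde_majorant c' D hd₁ m
  refine ⟨∑' h, u h, tsum_nonneg hu0, fun s hs => ?_⟩
  have hsumm : Summable fun h : ℕ => ‖(if h ∈ Skeleton.nset d₁ ∧ Nat.Coprime h m then
      Skeleton.kappaZ c' D (d₁ * h) / (h : ℂ) ^ s else 0)‖ :=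
    Summable.of_nonneg_of_le (fun _ => norm_nonneg _) (fun h => hle h s hs) hu
  rw [Skeleton.kappaTilde]
  exact (norm_tsum_le_tsum_norm hsumm).trans (Summable.tsum_le_tsum (fun h => hle h s hs) hsumm hu)

end KappaTilde

section Lam

variable (c' : ℝ) (D : ℕ)

/-- The shifts are purely imaginary: `Re β_j = 0`. [cite: Zhang2022LandauSiegel, §2 (2.13)] -/
private theorem beta_re :
    (Skeleton.beta1 c' D).re = 0 ∧ (Skeleton.beta2 c' D).re = 0 ∧ (Skeleton.beta3 c' D).re = 0 := by
  simp [Skeleton.beta1, Skeleton.beta2, Skeleton.beta3]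

/-- `‖q^{−w}‖ = q^{−Re w} < 1` for a prime `q` and `Re w > 0`. [folklore] -/
private theorem norm_prime_cpow_neg_lt_one {q : ℕ} (hq : q.Prime) {w : ℂ} (hw : 0 < w.re) :
    ‖(q : ℂ) ^ (-w)‖ < 1 := by
  rw [Complex.norm_natCast_cpow_of_pos hq.pos, Complex.neg_re]
  exact Real.rpow_lt_one_of_one_lt_of_neg (by exact_mod_cast hq.one_lt) (by linarith)

/-- `‖q^{−w}‖ ≤ 1/2` for a prime `q` and `Re w ≥ 1`. [folklore] -/
private theorem norm_prime_cpow_neg_le_half {q : ℕ} (hq : q.Prime) {w : ℂ} (hw : 1 ≤ w.re) :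
    ‖(q : ℂ) ^ (-w)‖ ≤ 1 / 2 := by
  rw [Complex.norm_natCast_cpow_of_pos hq.pos, Complex.neg_re]
  have hq2 : (2 : ℝ) ≤ q := by exact_mod_cast hq.two_le
  have hq0 : (0 : ℝ) < q := by linarith
  calc (q : ℝ) ^ (-w.re) ≤ (q : ℝ) ^ (-(1 : ℝ)) :=
        Real.rpow_le_rpow_of_exponent_le (by linarith) (by linarith)
    _ = (q : ℝ)⁻¹ := Real.rpow_neg_one _
    _ ≤ 2⁻¹ := by rw [inv_le_inv₀ hq0 (by norm_num)]; exact hq2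
    _ = 1 / 2 := by norm_num

/-- **`λ(m,·)` is holomorphic on `σ > 0`** (a finite product; `1 − q^{−s} ≠ 0` there).
[cite: Zhang2022LandauSiegel, §7 p.13] -/
theorem differentiableAt_lam (m : ℕ) {s : ℂ} (hs : 0 < s.re) :
    DifferentiableAt ℂ (Skeleton.lam c' D m) s := by
  have hfun : Skeleton.lam c' D m = fun s => ∏ q ∈ m.primeFactors,
      (1 - (q : ℂ) ^ (-(s + Skeleton.beta1 c' D))) * (1 - (q : ℂ) ^ (-(s + Skeleton.beta2 c' D))) *
        (1 - (q : ℂ) ^ (-(s + Skeleton.beta3 c' D))) / (1 - (q : ℂ) ^ (-s)) := by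
    funext s; rfl
  rw [hfun]
  refine DifferentiableAt.fun_finsetProd fun q hq => ?_
  have hq' : q.Prime := Nat.prime_of_mem_primeFactors hq
  have hq0 : (q : ℂ) ≠ 0 := Nat.cast_ne_zero.mpr hq'.ne_zero
  have hpow : ∀ b : ℂ, DifferentiableAt ℂ (fun s : ℂ => (q : ℂ) ^ (-(s + b))) s := fun b =>
    ((differentiableAt_id.add_const b).neg).const_cpow (Or.inl hq0)
  have hpow0 : DifferentiableAt ℂ (fun s : ℂ => (q : ℂ) ^ (-s)) s :=
    (differentiableAt_id.neg).const_cpow (Or.inl hq0)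
  have hden : (1 : ℂ) - (q : ℂ) ^ (-s) ≠ 0 := by
    intro h
    have h1 : ‖(q : ℂ) ^ (-s)‖ = 1 := by rw [← sub_eq_zero.mp h, norm_one]
    linarith [norm_prime_cpow_neg_lt_one hq' hs]
  exact ((((differentiableAt_const _).sub (hpow _)).mul ((differentiableAt_const _).sub (hpow _))).mul
    ((differentiableAt_const _).sub (hpow _))).div ((differentiableAt_const _).sub hpow0) hden

/-- **`λ(m,·)` is bounded on `σ ≥ 1`**: `‖λ(m,s)‖ ≤ 16^{ω(m)}` (each factor has modulus
`≤ 2·2·2/(1/2)`). [cite: Zhang2022LandauSiegel, §7 p.40] -/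
theorem norm_lam_le_pow (m : ℕ) {s : ℂ} (hs : 1 ≤ s.re) :
    ‖Skeleton.lam c' D m s‖ ≤ 16 ^ m.primeFactors.card := by
  rw [Skeleton.lam, ← Finset.prod_const]
  refine (Finset.norm_prod_le _ _).trans (Finset.prod_le_prod (fun _ _ => norm_nonneg _) fun q hq => ?_)
  have hq' : q.Prime := Nat.prime_of_mem_primeFactors hq
  obtain ⟨h1, h2, h3⟩ := beta_re c' D
  have hb : ∀ b : ℂ, b.re = 0 → ‖1 - (q : ℂ) ^ (-(s + b))‖ ≤ 2 := by
    intro b hb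
    have : ‖(q : ℂ) ^ (-(s + b))‖ ≤ 1 / 2 :=
      norm_prime_cpow_neg_le_half hq' (by rw [Complex.add_re, hb]; linarith)
    calc ‖1 - (q : ℂ) ^ (-(s + b))‖ ≤ ‖(1 : ℂ)‖ + ‖(q : ℂ) ^ (-(s + b))‖ := norm_sub_le _ _
      _ ≤ 1 + 1 / 2 := by rw [norm_one]; linarith
      _ ≤ 2 := by norm_num
  have hden : 1 / 2 ≤ ‖1 - (q : ℂ) ^ (-s)‖ := by
    have : ‖(q : ℂ) ^ (-s)‖ ≤ 1 / 2 := norm_prime_cpow_neg_le_half hq' hs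
    calc (1 : ℝ) / 2 ≤ ‖(1 : ℂ)‖ - ‖(q : ℂ) ^ (-s)‖ := by rw [norm_one]; linarith
      _ ≤ ‖1 - (q : ℂ) ^ (-s)‖ := norm_sub_norm_le _ _
  rw [norm_div, norm_mul, norm_mul, div_le_iff₀ (by linarith)]
  have e1 := hb _ h1
  have e2 := hb _ h2
  have e3 := hb _ h3
  have hn : 0 ≤ ‖1 - (q : ℂ) ^ (-(s + Skeleton.beta1 c' D))‖ := norm_nonneg _
  have hn2 : 0 ≤ ‖1 - (q : ℂ) ^ (-(s + Skeleton.beta2 c' D))‖ := norm_nonneg _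
  calc ‖1 - (q : ℂ) ^ (-(s + Skeleton.beta1 c' D))‖ * ‖1 - (q : ℂ) ^ (-(s + Skeleton.beta2 c' D))‖ *
        ‖1 - (q : ℂ) ^ (-(s + Skeleton.beta3 c' D))‖ ≤ 2 * 2 * 2 := by
        gcongr
    _ = 16 * (1 / 2) := by norm_num
    _ ≤ 16 * ‖1 - (q : ℂ) ^ (-s)‖ := by gcongr

end Lam

section ZetaBounds

/-- **`ζ` and `ζ⁻¹` are bounded on `σ ≥ 1 + a`** (`a > 0`): both by `Σ_n n^{−(1+a)}` (the series
for `ζ`, and `ζ⁻¹ = Σ μ(n)n^{−s}` with `|μ| ≤ 1`). [folklore] -/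
private theorem exists_zeta_bounds {a : ℝ} (ha : 0 < a) :
    ∃ Z : ℝ, 0 ≤ Z ∧ ∀ s : ℂ, 1 + a ≤ s.re → ‖riemannZeta s‖ ≤ Z ∧ ‖(riemannZeta s)⁻¹‖ ≤ Z := by
  set g : ℕ → ℝ := fun n => 1 / (n : ℝ) ^ (1 + a) with hg
  have hgs : Summable g := Real.summable_one_div_nat_rpow.mpr (by linarith)
  have hg0 : ∀ n, 0 ≤ g n := fun n => by positivity
  refine ⟨∑' n, g n, tsum_nonneg hg0, fun s hs => ?_⟩
  have hs1 : 1 < s.re := by linarith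
  -- termwise bound `‖n^{-s}‖ ≤ n^{-(1+a)}`
  have hterm : ∀ n : ℕ, ‖1 / (n : ℂ) ^ s‖ ≤ g n := by
    intro n
    rcases Nat.eq_zero_or_pos n with rfl | hn
    · have hs0 : s ≠ 0 := fun h => by rw [h, Complex.zero_re] at hs1; linarith
      simp only [Nat.cast_zero, Complex.zero_cpow hs0, div_zero, norm_zero]
      exact hg0 0
    · rw [norm_div, norm_one, Complex.norm_natCast_cpow_of_pos hn, hg]
      have hn1 : (1 : ℝ) ≤ n := by exact_mod_cast hn
      exact one_div_le_one_div_of_le (by positivity)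
        (Real.rpow_le_rpow_of_exponent_le hn1 hs)
  constructor
  · rw [zeta_eq_tsum_one_div_nat_cpow hs1]
    exact tsum_of_norm_bounded hgs.hasSum hterm
  · rw [← MeanSquareMajorant.LSeries_moebius_complex hs1, LSeries]
    refine tsum_of_norm_bounded hgs.hasSum fun n => ?_
    rcases Nat.eq_zero_or_pos n with rfl | hn
    · simp [LSeries.term_zero, hg0]
    · rw [LSeries.term_of_ne_zero hn.ne', ArithmeticFunction.intCoe_apply]
      calc ‖((ArithmeticFunction.moebius n : ℤ) : ℂ) / (n : ℂ) ^ s‖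
          = ‖((ArithmeticFunction.moebius n : ℤ) : ℂ)‖ * ‖1 / (n : ℂ) ^ s‖ := by
            rw [← norm_mul]; ring_nf
        _ ≤ 1 * g n := by
            refine mul_le_mul ?_ (hterm n) (norm_nonneg _) zero_le_one
            rw [Complex.norm_intCast]
            exact_mod_cast ArithmeticFunction.abs_moebius_le_one
        _ = g n := one_mul _

end ZetaBounds

/-! ## §C. The open set `U`, the simple-pole lemma -/

section OpenSet

/-- The set `U = {Re z > 19/20, z = 1 ∨ ζ(z) ≠ 0}` on which the regularised integrand is
holomorphic (off the three poles) is open: near `1`, `ζ ≠ 0` off `1` (`η(1) = 1 ≠ 0`); elsewhere by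
continuity of `ζ`. [folklore] -/
private theorem isOpen_goodSet :
    IsOpen {z : ℂ | 19 / 20 < z.re ∧ (z = 1 ∨ riemannZeta z ≠ 0)} := by
  have h1 : IsOpen {z : ℂ | 19 / 20 < z.re} := isOpen_lt continuous_const Complex.continuous_re
  have h2 : IsOpen {z : ℂ | z = 1 ∨ riemannZeta z ≠ 0} := by
    rw [isOpen_iff_mem_nhds]
    intro z hz
    rcases eq_or_ne z 1 with rfl | hz1
    · obtain ⟨ε, hε, -, hne⟩ := exists_ball_eta_differentiableOn
      filter_upwards [Metric.ball_mem_nhds (1 : ℂ) hε] with w hw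
      rcases eq_or_ne w 1 with rfl | hw1
      · exact Or.inl rfl
      · right
        intro hζ
        apply hne w hw
        rw [eta_of_ne hw1, hζ, mul_zero]
    · have hζ : riemannZeta z ≠ 0 := hz.resolve_left hz1
      have hc : ContinuousAt riemannZeta z := (differentiableAt_riemannZeta hz1).continuousAt
      filter_upwards [hc.eventually_ne hζ] with w hw
      exact Or.inr hw
  simpa only [Set.setOf_and] using h1.inter h2

end OpenSet

section Pole

/-- **Simple-pole lemma.** If `Φ` and `z ↦ η(z + β)` are differentiable on a neighbourhood `V` of
`p = 1 − β`, then `Φ(z)ζ(z+β) = φ(z)/(z − p)` on `V ∖ {p}` with `φ = Φ·η(·+β)` differentiable on `V`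
and `φ(p) = Φ(p)` (`η(1) = 1`). [folklore] -/
private theorem exists_pole_form {Φ : ℂ → ℂ} {β : ℂ} {V : Set ℂ} (hV : V ∈ 𝓝 (1 - β))
    (hΦ : DifferentiableOn ℂ Φ V)
    (hη : DifferentiableOn ℂ
      (fun z : ℂ => Function.update (fun s : ℂ => (s - 1) * riemannZeta s) 1 1 (z + β)) V) :
    ∃ φ : ℂ → ℂ, ∃ V' ∈ 𝓝 (1 - β), DifferentiableOn ℂ φ V' ∧ φ (1 - β) = Φ (1 - β) ∧
      ∀ z ∈ V', z ≠ 1 - β → Φ z * riemannZeta (z + β) = φ z / (z - (1 - β)) := by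
  refine ⟨fun z => Φ z * Function.update (fun s : ℂ => (s - 1) * riemannZeta s) 1 1 (z + β),
    V, hV, hΦ.mul hη, ?_, fun z _ hz => ?_⟩
  · simp only [sub_add_cancel, eta_one, mul_one]
  · rw [zeta_shift_eq_eta_div hz]
    ring

end Pole

/-! ## §D. The regularised integrand of (7.19): holomorphy, poles, bounds -/

section Integrand

variable {c' : ℝ} {D : ℕ} {d₁ m N : ℕ} {x : ℝ} {Fr : ℂ → ℂ}
  (hFr : ∀ s : ℂ, Fr s = (x : ℂ) ^ (-s) *
        (Skeleton.kappaTilde c' D d₁ m s * Skeleton.lam c' D N s *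
          (riemannZeta (s + Skeleton.beta1 c' D) * riemannZeta (s + Skeleton.beta2 c' D) *
            riemannZeta (s + Skeleton.beta3 c' D) *
            Function.update (fun z : ℂ => (riemannZeta z)⁻¹) 1 0 s * Skeleton.deltaW D s)))

include hFr

/-- Off `s = 1` the regularised integrand IS the integrand `x^{−s}κ̃(s)λ(s)·resFn(s)` of
`Step7u047`. [cite: Zhang2022LandauSiegel, (7.19) p.40] -/
theorem integrand_eq_of_ne_one {s : ℂ} (hs : s ≠ 1) :
    Fr s = ((x : ℝ) : ℂ) ^ (-s) *
      (Skeleton.kappaTilde c' D d₁ m s * Skeleton.lam c' D N s * resFn c' D s) := by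
  rw [hFr, zetaInvReg_of_ne hs, resFn, zetaRatio, div_eq_mul_inv]

/-- **Holomorphy of the regularised integrand** at every point of `U` other than the three poles
`1 − β_j` (`D ≥ 3`, `d₁ ≥ 1`, `x > 0`). [cite: Zhang2022LandauSiegel, §7 p.40] -/
theorem differentiableAt_integrand (hD : 3 ≤ D) (hd₁ : d₁ ≠ 0) (hx : 0 < x) {z : ℂ}
    (hz : 19 / 20 < z.re ∧ (z = 1 ∨ riemannZeta z ≠ 0))
    (h1 : z + Skeleton.beta1 c' D ≠ 1) (h2 : z + Skeleton.beta2 c' D ≠ 1)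
    (h3 : z + Skeleton.beta3 c' D ≠ 1) : DifferentiableAt ℂ Fr z := by
  have hfun : Fr = fun s => (x : ℂ) ^ (-s) *
        (Skeleton.kappaTilde c' D d₁ m s * Skeleton.lam c' D N s *
          (riemannZeta (s + Skeleton.beta1 c' D) * riemannZeta (s + Skeleton.beta2 c' D) *
            riemannZeta (s + Skeleton.beta3 c' D) *
            Function.update (fun z : ℂ => (riemannZeta z)⁻¹) 1 0 s * Skeleton.deltaW D s)) := funext hFr
  rw [hfun]
  have hz0 : 0 < z.re := by linarith [hz.1]
  have hx0 : (x : ℂ) ≠ 0 := Complex.ofReal_ne_zero.mpr hx.ne'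
  have hpow : DifferentiableAt ℂ (fun s : ℂ => (x : ℂ) ^ (-s)) z :=
    differentiableAt_id.neg.const_cpow (Or.inl hx0)
  have hκ : DifferentiableAt ℂ (Skeleton.kappaTilde c' D d₁ m) z :=
    (differentiableOn_kappaTilde c' D hd₁ m).differentiableAt
      ((isOpen_lt continuous_const Complex.continuous_re).mem_nhds hz.1)
  have hlam : DifferentiableAt ℂ (Skeleton.lam c' D N) z := differentiableAt_lam c' D N hz0
  have hζ : ∀ β : ℂ, z + β ≠ 1 → DifferentiableAt ℂ (fun s : ℂ => riemannZeta (s + β)) z :=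
    fun β hβ => (differentiableAt_riemannZeta hβ).comp z (differentiableAt_id.add_const β)
  have hι : DifferentiableAt ℂ (Function.update (fun z : ℂ => (riemannZeta z)⁻¹) 1 0) z :=
    differentiableAt_zetaInvReg' hz.2
  have hδ : DifferentiableAt ℂ (Skeleton.deltaW D) z := by
    have h := Lemma53.differentiableOn_delta514 (one_le_ell2 hD) (Skeleton.t0 D)
    exact (h z hz0).differentiableAt
      ((isOpen_lt continuous_const Complex.continuous_re).mem_nhds hz0)
  exact hpow.mul ((hκ.mul hlam).mul (((((hζ _ h1).mul (hζ _ h2)).mul (hζ _ h3)).mul hι).mul hδ))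

/-- **The pole at `1 − β₁`**, in the concrete shape required by the tree's residue theorem.
[cite: Zhang2022LandauSiegel, §7 p.40, tex L2118–L2126] -/
theorem pole_one (hD : 3 ≤ D) (hd₁ : d₁ ≠ 0) (hx : 0 < x) {V : Set ℂ}
    (hVopen : IsOpen V) (hpV : 1 - Skeleton.beta1 c' D ∈ V)
    (hVU : V ⊆ {z : ℂ | 19 / 20 < z.re ∧ (z = 1 ∨ riemannZeta z ≠ 0)})
    (hV2 : ∀ z ∈ V, z + Skeleton.beta2 c' D ≠ 1) (hV3 : ∀ z ∈ V, z + Skeleton.beta3 c' D ≠ 1)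
    (hVη : DifferentiableOn ℂ (fun z : ℂ =>
      Function.update (fun s : ℂ => (s - 1) * riemannZeta s) 1 1 (z + Skeleton.beta1 c' D)) V) :
    ∃ φ : ℂ → ℂ, ∃ V' ∈ 𝓝 (1 - Skeleton.beta1 c' D), DifferentiableOn ℂ φ V' ∧
      φ (1 - Skeleton.beta1 c' D) =
        ((x : ℂ) ^ (-(1 - Skeleton.beta1 c' D)) *
          (Skeleton.kappaTilde c' D d₁ m (1 - Skeleton.beta1 c' D) *
            Skeleton.lam c' D N (1 - Skeleton.beta1 c' D) *
            (riemannZeta (1 - Skeleton.beta1 c' D + Skeleton.beta2 c' D) *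
              riemannZeta (1 - Skeleton.beta1 c' D + Skeleton.beta3 c' D) *
              Function.update (fun z : ℂ => (riemannZeta z)⁻¹) 1 0 (1 - Skeleton.beta1 c' D) *
              Skeleton.deltaW D (1 - Skeleton.beta1 c' D)))) ∧
      ∀ z ∈ V', z ≠ 1 - Skeleton.beta1 c' D → Fr z = φ z / (z - (1 - Skeleton.beta1 c' D)) := by
  set Φ : ℂ → ℂ := fun s => (x : ℂ) ^ (-s) *
    (Skeleton.kappaTilde c' D d₁ m s * Skeleton.lam c' D N s *
      (riemannZeta (s + Skeleton.beta2 c' D) * riemannZeta (s + Skeleton.beta3 c' D) *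
        Function.update (fun z : ℂ => (riemannZeta z)⁻¹) 1 0 s * Skeleton.deltaW D s)) with hΦ
  have hFrΦ : ∀ s, Fr s = Φ s * riemannZeta (s + Skeleton.beta1 c' D) := by
    intro s; rw [hFr]; simp only [hΦ]; ring
  have hΦd : DifferentiableOn ℂ Φ V := by
    intro z hzV
    have hz := hVU hzV
    have hz0 : 0 < z.re := by linarith [hz.1]
    have hx0 : (x : ℂ) ≠ 0 := Complex.ofReal_ne_zero.mpr hx.ne'
    have hpow : DifferentiableAt ℂ (fun s : ℂ => (x : ℂ) ^ (-s)) z :=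
      differentiableAt_id.neg.const_cpow (Or.inl hx0)
    have hκ : DifferentiableAt ℂ (Skeleton.kappaTilde c' D d₁ m) z :=
      (differentiableOn_kappaTilde c' D hd₁ m).differentiableAt
        ((isOpen_lt continuous_const Complex.continuous_re).mem_nhds hz.1)
    have hlam : DifferentiableAt ℂ (Skeleton.lam c' D N) z := differentiableAt_lam c' D N hz0
    have hζ : ∀ β : ℂ, z + β ≠ 1 → DifferentiableAt ℂ (fun s : ℂ => riemannZeta (s + β)) z :=
      fun β hβ => (differentiableAt_riemannZeta hβ).comp z (differentiableAt_id.add_const β)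
    have hι : DifferentiableAt ℂ (Function.update (fun z : ℂ => (riemannZeta z)⁻¹) 1 0) z :=
      differentiableAt_zetaInvReg' hz.2
    have hδ : DifferentiableAt ℂ (Skeleton.deltaW D) z := by
      have h := Lemma53.differentiableOn_delta514 (one_le_ell2 hD) (Skeleton.t0 D)
      exact (h z hz0).differentiableAt
        ((isOpen_lt continuous_const Complex.continuous_re).mem_nhds hz0)
    exact (hpow.mul ((hκ.mul hlam).mul ((((hζ _ (hV2 z hzV)).mul (hζ _ (hV3 z hzV))).mul hι).mul
      hδ))).differentiableWithinAt
  obtain ⟨φ, V', hV', hφd, hφp, hφ⟩ :=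
    exists_pole_form (hVopen.mem_nhds hpV) hΦd hVη
  refine ⟨φ, V', hV', hφd, ?_, fun z hz hzp => ?_⟩
  · rw [hφp]
  · rw [hFrΦ]; exact hφ z hz hzp

/-- **The pole at `1 − β₂`**, in the concrete shape required by the tree's residue theorem.
[cite: Zhang2022LandauSiegel, §7 p.40, tex L2118–L2126] -/
theorem pole_two (hD : 3 ≤ D) (hd₁ : d₁ ≠ 0) (hx : 0 < x) {V : Set ℂ}
    (hVopen : IsOpen V) (hpV : 1 - Skeleton.beta2 c' D ∈ V)
    (hVU : V ⊆ {z : ℂ | 19 / 20 < z.re ∧ (z = 1 ∨ riemannZeta z ≠ 0)})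
    (hV1 : ∀ z ∈ V, z + Skeleton.beta1 c' D ≠ 1) (hV3 : ∀ z ∈ V, z + Skeleton.beta3 c' D ≠ 1)
    (hVη : DifferentiableOn ℂ (fun z : ℂ =>
      Function.update (fun s : ℂ => (s - 1) * riemannZeta s) 1 1 (z + Skeleton.beta2 c' D)) V) :
    ∃ φ : ℂ → ℂ, ∃ V' ∈ 𝓝 (1 - Skeleton.beta2 c' D), DifferentiableOn ℂ φ V' ∧
      φ (1 - Skeleton.beta2 c' D) =
        ((x : ℂ) ^ (-(1 - Skeleton.beta2 c' D)) *
          (Skeleton.kappaTilde c' D d₁ m (1 - Skeleton.beta2 c' D) *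
            Skeleton.lam c' D N (1 - Skeleton.beta2 c' D) *
            (riemannZeta (1 - Skeleton.beta2 c' D + Skeleton.beta1 c' D) *
              riemannZeta (1 - Skeleton.beta2 c' D + Skeleton.beta3 c' D) *
              Function.update (fun z : ℂ => (riemannZeta z)⁻¹) 1 0 (1 - Skeleton.beta2 c' D) *
              Skeleton.deltaW D (1 - Skeleton.beta2 c' D)))) ∧
      ∀ z ∈ V', z ≠ 1 - Skeleton.beta2 c' D → Fr z = φ z / (z - (1 - Skeleton.beta2 c' D)) := by
  set Φ : ℂ → ℂ := fun s => (x : ℂ) ^ (-s) *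
    (Skeleton.kappaTilde c' D d₁ m s * Skeleton.lam c' D N s *
      (riemannZeta (s + Skeleton.beta1 c' D) * riemannZeta (s + Skeleton.beta3 c' D) *
        Function.update (fun z : ℂ => (riemannZeta z)⁻¹) 1 0 s * Skeleton.deltaW D s)) with hΦ
  have hFrΦ : ∀ s, Fr s = Φ s * riemannZeta (s + Skeleton.beta2 c' D) := by
    intro s; rw [hFr]; simp only [hΦ]; ring
  have hΦd : DifferentiableOn ℂ Φ V := by
    intro z hzV
    have hz := hVU hzV
    have hz0 : 0 < z.re := by linarith [hz.1]
    have hx0 : (x : ℂ) ≠ 0 := Complex.ofReal_ne_zero.mpr hx.ne'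
    have hpow : DifferentiableAt ℂ (fun s : ℂ => (x : ℂ) ^ (-s)) z :=
      differentiableAt_id.neg.const_cpow (Or.inl hx0)
    have hκ : DifferentiableAt ℂ (Skeleton.kappaTilde c' D d₁ m) z :=
      (differentiableOn_kappaTilde c' D hd₁ m).differentiableAt
        ((isOpen_lt continuous_const Complex.continuous_re).mem_nhds hz.1)
    have hlam : DifferentiableAt ℂ (Skeleton.lam c' D N) z := differentiableAt_lam c' D N hz0
    have hζ : ∀ β : ℂ, z + β ≠ 1 → DifferentiableAt ℂ (fun s : ℂ => riemannZeta (s + β)) z :=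
      fun β hβ => (differentiableAt_riemannZeta hβ).comp z (differentiableAt_id.add_const β)
    have hι : DifferentiableAt ℂ (Function.update (fun z : ℂ => (riemannZeta z)⁻¹) 1 0) z :=
      differentiableAt_zetaInvReg' hz.2
    have hδ : DifferentiableAt ℂ (Skeleton.deltaW D) z := by
      have h := Lemma53.differentiableOn_delta514 (one_le_ell2 hD) (Skeleton.t0 D)
      exact (h z hz0).differentiableAt
        ((isOpen_lt continuous_const Complex.continuous_re).mem_nhds hz0)
    exact (hpow.mul ((hκ.mul hlam).mul ((((hζ _ (hV1 z hzV)).mul (hζ _ (hV3 z hzV))).mul hι).mul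
      hδ))).differentiableWithinAt
  obtain ⟨φ, V', hV', hφd, hφp, hφ⟩ :=
    exists_pole_form (hVopen.mem_nhds hpV) hΦd hVη
  refine ⟨φ, V', hV', hφd, ?_, fun z hz hzp => ?_⟩
  · rw [hφp]
  · rw [hFrΦ]; exact hφ z hz hzp

/-- **The pole at `1 − β₃`**, in the concrete shape required by the tree's residue theorem.
[cite: Zhang2022LandauSiegel, §7 p.40, tex L2118–L2126] -/
theorem pole_three (hD : 3 ≤ D) (hd₁ : d₁ ≠ 0) (hx : 0 < x) {V : Set ℂ}
    (hVopen : IsOpen V) (hpV : 1 - Skeleton.beta3 c' D ∈ V)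
    (hVU : V ⊆ {z : ℂ | 19 / 20 < z.re ∧ (z = 1 ∨ riemannZeta z ≠ 0)})
    (hV1 : ∀ z ∈ V, z + Skeleton.beta1 c' D ≠ 1) (hV2 : ∀ z ∈ V, z + Skeleton.beta2 c' D ≠ 1)
    (hVη : DifferentiableOn ℂ (fun z : ℂ =>
      Function.update (fun s : ℂ => (s - 1) * riemannZeta s) 1 1 (z + Skeleton.beta3 c' D)) V) :
    ∃ φ : ℂ → ℂ, ∃ V' ∈ 𝓝 (1 - Skeleton.beta3 c' D), DifferentiableOn ℂ φ V' ∧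
      φ (1 - Skeleton.beta3 c' D) =
        ((x : ℂ) ^ (-(1 - Skeleton.beta3 c' D)) *
          (Skeleton.kappaTilde c' D d₁ m (1 - Skeleton.beta3 c' D) *
            Skeleton.lam c' D N (1 - Skeleton.beta3 c' D) *
            (riemannZeta (1 - Skeleton.beta3 c' D + Skeleton.beta1 c' D) *
              riemannZeta (1 - Skeleton.beta3 c' D + Skeleton.beta2 c' D) *
              Function.update (fun z : ℂ => (riemannZeta z)⁻¹) 1 0 (1 - Skeleton.beta3 c' D) *
              Skeleton.deltaW D (1 - Skeleton.beta3 c' D)))) ∧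
      ∀ z ∈ V', z ≠ 1 - Skeleton.beta3 c' D → Fr z = φ z / (z - (1 - Skeleton.beta3 c' D)) := by
  set Φ : ℂ → ℂ := fun s => (x : ℂ) ^ (-s) *
    (Skeleton.kappaTilde c' D d₁ m s * Skeleton.lam c' D N s *
      (riemannZeta (s + Skeleton.beta1 c' D) * riemannZeta (s + Skeleton.beta2 c' D) *
        Function.update (fun z : ℂ => (riemannZeta z)⁻¹) 1 0 s * Skeleton.deltaW D s)) with hΦ
  have hFrΦ : ∀ s, Fr s = Φ s * riemannZeta (s + Skeleton.beta3 c' D) := by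
    intro s; rw [hFr]; simp only [hΦ]; ring
  have hΦd : DifferentiableOn ℂ Φ V := by
    intro z hzV
    have hz := hVU hzV
    have hz0 : 0 < z.re := by linarith [hz.1]
    have hx0 : (x : ℂ) ≠ 0 := Complex.ofReal_ne_zero.mpr hx.ne'
    have hpow : DifferentiableAt ℂ (fun s : ℂ => (x : ℂ) ^ (-s)) z :=
      differentiableAt_id.neg.const_cpow (Or.inl hx0)
    have hκ : DifferentiableAt ℂ (Skeleton.kappaTilde c' D d₁ m) z :=
      (differentiableOn_kappaTilde c' D hd₁ m).differentiableAt
        ((isOpen_lt continuous_const Complex.continuous_re).mem_nhds hz.1)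
    have hlam : DifferentiableAt ℂ (Skeleton.lam c' D N) z := differentiableAt_lam c' D N hz0
    have hζ : ∀ β : ℂ, z + β ≠ 1 → DifferentiableAt ℂ (fun s : ℂ => riemannZeta (s + β)) z :=
      fun β hβ => (differentiableAt_riemannZeta hβ).comp z (differentiableAt_id.add_const β)
    have hι : DifferentiableAt ℂ (Function.update (fun z : ℂ => (riemannZeta z)⁻¹) 1 0) z :=
      differentiableAt_zetaInvReg' hz.2
    have hδ : DifferentiableAt ℂ (Skeleton.deltaW D) z := by
      have h := Lemma53.differentiableOn_delta514 (one_le_ell2 hD) (Skeleton.t0 D)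
      exact (h z hz0).differentiableAt
        ((isOpen_lt continuous_const Complex.continuous_re).mem_nhds hz0)
    exact (hpow.mul ((hκ.mul hlam).mul ((((hζ _ (hV1 z hzV)).mul (hζ _ (hV2 z hzV))).mul hι).mul
      hδ))).differentiableWithinAt
  obtain ⟨φ, V', hV', hφd, hφp, hφ⟩ :=
    exists_pole_form (hVopen.mem_nhds hpV) hΦd hVη
  refine ⟨φ, V', hV', hφd, ?_, fun z hz hzp => ?_⟩
  · rw [hφp]
  · rw [hFrΦ]; exact hφ z hz hzp

/-- **Uniform bound on the strip `1 + α ≤ σ ≤ 3/2`**: `‖Fr(σ+it)‖ ≤ C₀(1+t²)⁻¹`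
(`|x^{−s}| ≤ x^{−1−α} + x^{−3/2}`, `κ̃, λ, ζ(s+β_j), ζ(s)⁻¹` bounded, `|δ(s)| ≤ K/|s|²`).
[cite: Zhang2022LandauSiegel, §7 p.40 ("standard estimates")] -/
theorem exists_integrand_bound (hD : 3 ≤ D) (hα : 0 < Skeleton.alpha D) (hd₁ : d₁ ≠ 0)
    (hx : 0 < x) :
    ∃ C₀ : ℝ, 0 ≤ C₀ ∧ ∀ σ : ℝ, 1 + Skeleton.alpha D ≤ σ → σ ≤ 3 / 2 → ∀ t : ℝ,
      ‖Fr ((σ : ℂ) + t * I)‖ ≤ C₀ * (1 + t ^ 2)⁻¹ := by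
  obtain ⟨Kκ, hKκ0, hKκ⟩ := exists_norm_kappaTilde_le c' D hd₁ m
  obtain ⟨Z, hZ0, hZ⟩ := exists_zeta_bounds hα
  obtain ⟨hb1, hb2, hb3⟩ := beta_re c' D
  set Kδ : ℝ := ∫ y in Ioi (0 : ℝ), ‖Lemma53.phaseInt 2 (Skeleton.ell2 D) (Skeleton.t0 D) y‖ *
    (y ^ (3 / 2 : ℝ) + y ^ (3 : ℝ)) with hKδ
  have hKδ0 : 0 ≤ Kδ := setIntegral_nonneg measurableSet_Ioi fun y hy => by
    have hy' : (0 : ℝ) < y := hy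
    positivity
  set X₀ : ℝ := x ^ (-(1 + Skeleton.alpha D)) + x ^ (-(3 / 2 : ℝ)) with hX₀
  have hX₀0 : 0 ≤ X₀ := by positivity
  refine ⟨X₀ * (Kκ * 16 ^ N.primeFactors.card * (Z * Z * Z * Z * Kδ)), by positivity,
    fun σ hσ1 hσ2 t => ?_⟩
  set s : ℂ := (σ : ℂ) + t * I with hsdef
  have hre : s.re = σ := by simp [hsdef]
  have him : s.im = t := by simp [hsdef]
  have hσ1' : 1 < σ := by linarith
  have hs1 : s ≠ 1 := fun h => by
    have := congrArg Complex.re h; rw [hre, Complex.one_re] at this; linarith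
  -- the factors
  have h_x : ‖(x : ℂ) ^ (-s)‖ ≤ X₀ := by
    rw [Complex.norm_cpow_eq_rpow_re_of_pos hx, Complex.neg_re, hre]
    rcases le_or_gt x 1 with hx1 | hx1
    · have : x ^ (-σ) ≤ x ^ (-(3 / 2 : ℝ)) :=
        Real.rpow_le_rpow_of_exponent_ge hx hx1 (by linarith)
      have h0 : 0 ≤ x ^ (-(1 + Skeleton.alpha D)) := by positivity
      linarith
    · have : x ^ (-σ) ≤ x ^ (-(1 + Skeleton.alpha D)) :=
        Real.rpow_le_rpow_of_exponent_le hx1.le (by linarith)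
      have h0 : 0 ≤ x ^ (-(3 / 2 : ℝ)) := by positivity
      linarith
  have h_κ : ‖Skeleton.kappaTilde c' D d₁ m s‖ ≤ Kκ := hKκ s (by rw [hre]; linarith)
  have h_lam : ‖Skeleton.lam c' D N s‖ ≤ 16 ^ N.primeFactors.card :=
    norm_lam_le_pow c' D N (by rw [hre]; linarith)
  have h_ζ : ∀ β : ℂ, β.re = 0 → ‖riemannZeta (s + β)‖ ≤ Z := fun β hβ =>
    (hZ (s + β) (by rw [Complex.add_re, hβ, hre]; linarith)).1
  have h_ι : ‖Function.update (fun z : ℂ => (riemannZeta z)⁻¹) 1 0 s‖ ≤ Z := by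
    rw [zetaInvReg_of_ne hs1]
    exact (hZ s (by rw [hre]; linarith)).2
  have h_δ : ‖Skeleton.deltaW D s‖ ≤ Kδ * (1 + t ^ 2)⁻¹ := by
    have h := Lemma53.norm_delta514_le (one_le_ell2 hD) (Skeleton.t0 D) (s := s)
      (by rw [hre]; linarith) (by rw [hre]; linarith)
    have hnorm : 1 + t ^ 2 ≤ ‖s‖ ^ 2 := by
      rw [Complex.sq_norm, Complex.normSq_apply, hre, him]
      nlinarith
    have hpos : (0 : ℝ) < 1 + t ^ 2 := by positivity
    calc ‖Skeleton.deltaW D s‖ ≤ Kδ / ‖s‖ ^ 2 := h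
      _ ≤ Kδ / (1 + t ^ 2) := div_le_div_of_nonneg_left hKδ0 hpos hnorm
      _ = Kδ * (1 + t ^ 2)⁻¹ := div_eq_mul_inv _ _
  rw [hFr]
  simp only [norm_mul]
  calc ‖(x : ℂ) ^ (-s)‖ * (‖Skeleton.kappaTilde c' D d₁ m s‖ * ‖Skeleton.lam c' D N s‖ *
        (‖riemannZeta (s + Skeleton.beta1 c' D)‖ * ‖riemannZeta (s + Skeleton.beta2 c' D)‖ *
          ‖riemannZeta (s + Skeleton.beta3 c' D)‖ *
          ‖Function.update (fun z : ℂ => (riemannZeta z)⁻¹) 1 0 s‖ * ‖Skeleton.deltaW D s‖))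
      ≤ X₀ * (Kκ * 16 ^ N.primeFactors.card * (Z * Z * Z * Z * (Kδ * (1 + t ^ 2)⁻¹))) := by
        gcongr
        · exact h_ζ _ hb1
        · exact h_ζ _ hb2
        · exact h_ζ _ hb3
    _ = X₀ * (Kκ * 16 ^ N.primeFactors.card * (Z * Z * Z * Z * Kδ)) * (1 + t ^ 2)⁻¹ := by ring

/-- **Continuity along every vertical line `σ > 1`** (the integrand is holomorphic there: no pole
has real part `≠ 1`, and `ζ ≠ 0`). [cite: Zhang2022LandauSiegel, §7 p.40] -/
theorem continuous_integrand_line (hD : 3 ≤ D) (hd₁ : d₁ ≠ 0) (hx : 0 < x) {σ : ℝ} (hσ : 1 < σ) :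
    Continuous fun t : ℝ => Fr ((σ : ℂ) + t * I) := by
  obtain ⟨hb1, hb2, hb3⟩ := beta_re c' D
  refine continuous_iff_continuousAt.mpr fun t => ?_
  set z : ℂ := (σ : ℂ) + t * I with hz
  have hre : z.re = σ := by simp [hz]
  have hzU : 19 / 20 < z.re ∧ (z = 1 ∨ riemannZeta z ≠ 0) :=
    ⟨by rw [hre]; linarith, Or.inr (riemannZeta_ne_zero_of_one_lt_re (by rw [hre]; exact hσ))⟩
  have hne : ∀ β : ℂ, β.re = 0 → z + β ≠ 1 := fun β hβ h => by
    have := congrArg Complex.re h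
    rw [Complex.add_re, hβ, hre, Complex.one_re] at this; linarith
  have hd := differentiableAt_integrand hFr hD hd₁ hx hzU (hne _ hb1) (hne _ hb2) (hne _ hb3)
  have hcont : ContinuousAt (fun t : ℝ => (σ : ℂ) + t * I) t := by fun_prop
  exact hd.continuousAt.comp_of_eq hcont rfl

/-- **Absolute integrability along the lines `σ ∈ [1+α, 3/2]`.** [cite: Zhang2022LandauSiegel, §7 p.40] -/
theorem integrable_integrand_line (hD : 3 ≤ D) (hα : 0 < Skeleton.alpha D) (hd₁ : d₁ ≠ 0)
    (hx : 0 < x) {σ : ℝ} (hσ1 : 1 + Skeleton.alpha D ≤ σ) (hσ2 : σ ≤ 3 / 2) :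
    Integrable fun t : ℝ => Fr ((σ : ℂ) + t * I) := by
  obtain ⟨C₀, -, hC₀⟩ := exists_integrand_bound hFr hD hα hd₁ hx
  refine Integrable.mono' (integrable_inv_one_add_sq.const_mul C₀)
    (continuous_integrand_line hFr hD hd₁ hx (by linarith)).aestronglyMeasurable
    (Eventually.of_forall fun t => hC₀ σ hσ1 hσ2 t)

/-- **Decay on the horizontal segments `[1+α, 3/2] + iT`**, uniformly as `|T| → ∞`.
[cite: Zhang2022LandauSiegel, §7 p.40] -/
theorem decay_integrand (hD : 3 ≤ D) (hα : 0 < Skeleton.alpha D) (hd₁ : d₁ ≠ 0) (hx : 0 < x) :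
    ∀ ε : ℝ, 0 < ε → ∃ T₀ : ℝ, ∀ T : ℝ, T₀ ≤ |T| →
      ∀ σ ∈ Icc (1 + Skeleton.alpha D) (3 / 2), ‖Fr ((σ : ℂ) + T * I)‖ ≤ ε := by
  obtain ⟨C₀, hC₀0, hC₀⟩ := exists_integrand_bound hFr hD hα hd₁ hx
  intro ε hε
  refine ⟨max 1 (C₀ / ε), fun T hT σ hσ => ?_⟩
  have h1 : 1 ≤ |T| := le_trans (le_max_left _ _) hT
  have h2 : C₀ / ε ≤ |T| := le_trans (le_max_right _ _) hT
  have hT2 : |T| ≤ 1 + T ^ 2 := by rw [← sq_abs]; nlinarith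
  have hC : C₀ ≤ ε * (1 + T ^ 2) := by
    rw [div_le_iff₀ hε] at h2; nlinarith
  have hpos : (0 : ℝ) < 1 + T ^ 2 := by positivity
  calc ‖Fr ((σ : ℂ) + T * I)‖ ≤ C₀ * (1 + T ^ 2)⁻¹ := hC₀ σ hσ.1 hσ.2 T
    _ ≤ ε := by rw [← div_eq_mul_inv, div_le_iff₀ hpos]; exact hC

end Integrand

/-! ## §E. The residue values and the main theorem -/

section Main

/-- `β_j` for `j = 1, …, 5` (`β₄ = β₁`, `β₅ = β₂`). [cite: Zhang2022LandauSiegel, §8 p.45] -/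
private theorem betaJ_vals (c' : ℝ) (D : ℕ) :
    Skeleton.betaJ c' D 1 = Skeleton.beta1 c' D ∧ Skeleton.betaJ c' D 2 = Skeleton.beta2 c' D ∧
      Skeleton.betaJ c' D 3 = Skeleton.beta3 c' D ∧ Skeleton.betaJ c' D 4 = Skeleton.beta1 c' D ∧
      Skeleton.betaJ c' D 5 = Skeleton.beta2 c' D := by
  simp [Skeleton.betaJ]

/-- The shifts in the form `β_j = i·b_j`. [cite: Zhang2022LandauSiegel, §2 (2.13)] -/
private theorem beta_eq_b_mul_I (c' : ℝ) (D : ℕ) :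
    Skeleton.beta1 c' D = (Skeleton.b1 c' D : ℂ) * I ∧ Skeleton.beta2 c' D = (Skeleton.b2 c' D : ℂ) * I ∧
      Skeleton.beta3 c' D = (Skeleton.b3 c' D : ℂ) * I := by
  refine ⟨?_, ?_, ?_⟩
  · simp only [Skeleton.beta1, Skeleton.b1]; push_cast; ring
  · simp only [Skeleton.beta2, Skeleton.b2]; push_cast; ring
  · simp only [Skeleton.beta3, Skeleton.b3]; push_cast; ring

/-- **The three residues are the printed ones**: the values `φ_j(1−β_j)` of the pole lemmas sum to
`Σ_{j≤3} 𝔯ⱼ κ̃₀ⱼ(d₁;m) λ₀ⱼ(N) x^{−(1−β_j)}` (`𝔯ⱼ` = `frakr`, §7 p. 40; `β_j ≠ 0` so that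
`ζ(1−β_j)⁻¹` is the regularised reciprocal there). [cite: Zhang2022LandauSiegel, §7 p.40, tex L2118–L2126] -/
theorem residue_sum_eq (c' : ℝ) (D : ℕ) (d₁ m N : ℕ) (x : ℝ)
    (h1 : Skeleton.beta1 c' D ≠ 0) (h2 : Skeleton.beta2 c' D ≠ 0) (h3 : Skeleton.beta3 c' D ≠ 0) :
    (x : ℂ) ^ (-(1 - Skeleton.beta1 c' D)) *
          (Skeleton.kappaTilde c' D d₁ m (1 - Skeleton.beta1 c' D) *
            Skeleton.lam c' D N (1 - Skeleton.beta1 c' D) *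
            (riemannZeta (1 - Skeleton.beta1 c' D + Skeleton.beta2 c' D) *
              riemannZeta (1 - Skeleton.beta1 c' D + Skeleton.beta3 c' D) *
              Function.update (fun z : ℂ => (riemannZeta z)⁻¹) 1 0 (1 - Skeleton.beta1 c' D) *
              Skeleton.deltaW D (1 - Skeleton.beta1 c' D))) +
      (x : ℂ) ^ (-(1 - Skeleton.beta2 c' D)) *
          (Skeleton.kappaTilde c' D d₁ m (1 - Skeleton.beta2 c' D) *
            Skeleton.lam c' D N (1 - Skeleton.beta2 c' D) *
            (riemannZeta (1 - Skeleton.beta2 c' D + Skeleton.beta1 c' D) *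
              riemannZeta (1 - Skeleton.beta2 c' D + Skeleton.beta3 c' D) *
              Function.update (fun z : ℂ => (riemannZeta z)⁻¹) 1 0 (1 - Skeleton.beta2 c' D) *
              Skeleton.deltaW D (1 - Skeleton.beta2 c' D))) +
      (x : ℂ) ^ (-(1 - Skeleton.beta3 c' D)) *
          (Skeleton.kappaTilde c' D d₁ m (1 - Skeleton.beta3 c' D) *
            Skeleton.lam c' D N (1 - Skeleton.beta3 c' D) *
            (riemannZeta (1 - Skeleton.beta3 c' D + Skeleton.beta1 c' D) *
              riemannZeta (1 - Skeleton.beta3 c' D + Skeleton.beta2 c' D) *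
              Function.update (fun z : ℂ => (riemannZeta z)⁻¹) 1 0 (1 - Skeleton.beta3 c' D) *
              Skeleton.deltaW D (1 - Skeleton.beta3 c' D))) =
      ∑ j ∈ Finset.Icc 1 3,
        frakr c' D j * Skeleton.kappaTildeZero c' D j d₁ m * Skeleton.lamZero c' D j N *
          (x : ℂ) ^ (-(1 - Skeleton.betaJ c' D j)) := by
  obtain ⟨e1, e2, e3, e4, e5⟩ := betaJ_vals c' D
  have hne1 : (1 : ℂ) - Skeleton.beta1 c' D ≠ 1 := fun h => h1 (by linear_combination -h)
  have hne2 : (1 : ℂ) - Skeleton.beta2 c' D ≠ 1 := fun h => h2 (by linear_combination -h)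
  have hne3 : (1 : ℂ) - Skeleton.beta3 c' D ≠ 1 := fun h => h3 (by linear_combination -h)
  rw [show Finset.Icc 1 3 = ({1, 2, 3} : Finset ℕ) by decide, Finset.sum_insert (by decide),
    Finset.sum_insert (by decide), Finset.sum_singleton]
  simp only [frakr, Skeleton.kappaTildeZero, Skeleton.lamZero, e1, e2, e3, e4, e5,
    show (2 : ℕ) + 1 = 3 from rfl, show (2 : ℕ) + 2 = 4 from rfl,
    show (3 : ℕ) + 2 = 5 from rfl, show (1 : ℕ) + 1 = 2 from rfl,
    zetaInvReg_of_ne hne1, zetaInvReg_of_ne hne2, zetaInvReg_of_ne hne3, div_eq_mul_inv]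
  ring

/-- **`Z22:§7.u047` HOLDS — the contour move in (7.19)** (node `Section7dStatements.Step7u047 c′`;
§7 p. 40, tex L2108–L2117): "… for `σ > 9/10`, we can move the contour of integration in (7.19) to
the vertical segments `s = 1 + α + it` with `|t| ≥ D`, `s = 1 − 𝓛⁻¹ + it` with `|t| ≤ D` and to
the two connecting horizontal segments `s = σ ± iD` with `1 − 𝓛⁻¹ ≤ σ ≤ 1 + α`" — i.e.
`mellinInv (3/2) (κ̃λ·resFn) (l₂/(pk)) = contour719 D (x^{−s}κ̃λ·resFn) + Σ_{j≤3} 𝔯ⱼκ̃₀ⱼλ₀ⱼx^{−(1−β_j)}`,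
for all large `D`, under (A) (used exactly once: `ζ(s) ≠ 0` for `σ ≥ 1 − 𝓛⁻¹`, `|t| ≤ D`, the
tree's `zeta_ne_zero_of_assumptionA`, gap-ledger row G-adj2-3). Proof: shift the line `σ = 3/2`
to `σ = 1 + α` (no poles; tree `integral_vertical_eq_of_differentiableOn`), then apply the
residue theorem to the rectangle `[1 − 𝓛⁻¹, 1 + α] × [−D, D]` (tree
`rectBoundaryIntegral_eq_sum_of_simplePoles`) whose interior contains the three simple poles
`1 − β_j` of `ζ(s+β_j)`; the integrand used is the regularised one (`ζ(s)⁻¹` replaced by `0` at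
`s = 1`, where the literal quotient has a removable singularity), which agrees with the printed one
on every contour. [cite: Zhang2022LandauSiegel, §7 p.40, tex L2108–L2117] -/
theorem step7u047_holds (c' : ℝ) : Step7u047 c' := by
  obtain ⟨D₁, hZfree⟩ := zeta_ne_zero_of_assumptionA
  refine ⟨max D₁ ⌈Real.exp (20 * Real.pi * |c'| + 21)⌉₊,
    fun D _ χ hD hq hprim hA p hp d₁ d₂ k l₂ hd₁ hd₂ hk hl₂ _ _ => ?_⟩
  /- 1. parameters -/
  have hD₁ : D₁ ≤ D := le_trans (le_max_left _ _) hD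
  have hDc : ⌈Real.exp (20 * Real.pi * |c'| + 21)⌉₊ ≤ D := le_trans (le_max_right _ _) hD
  have hexp : Real.exp (20 * Real.pi * |c'| + 21) ≤ D := le_trans (Nat.le_ceil _) (by exact_mod_cast hDc)
  have hDc3 : ⌈Real.exp (20 * Real.pi * |c'| + 3)⌉₊ ≤ D := by
    refine le_trans (Nat.ceil_mono (Real.exp_le_exp.mpr (by linarith))) hDc
  obtain ⟨hℓ3, hα, hcαℓ⟩ := Residue750.large_D (c' := c') hDc3
  obtain ⟨hb1pos, hb12, hb23⟩ := Residue750.b_chain hα hcαℓ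
  have hDpos : (0 : ℝ) < D := lt_of_lt_of_le (Real.exp_pos _) hexp
  have hℓ21 : 21 ≤ Skeleton.ell D := by
    have h := (Real.le_log_iff_exp_le hDpos).mpr hexp
    have hc0 : 0 ≤ 20 * Real.pi * |c'| := by positivity
    rw [Skeleton.ell]; linarith
  have hD3 : 3 ≤ D := by
    have h3 : (3 : ℝ) ≤ Real.exp (20 * Real.pi * |c'| + 21) := by
      have := Real.add_one_le_exp (20 * Real.pi * |c'| + 21)
      have hc0 : 0 ≤ 20 * Real.pi * |c'| := by positivity
      linarith
    exact_mod_cast h3.trans hexp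
  have hℓpos : 0 < Skeleton.ell D := by linarith
  have hαval : Skeleton.alpha D = Real.pi / Skeleton.ell D ^ 9 := by
    rw [Skeleton.alpha, Skeleton.bigP, Real.log_exp]
  have hα5 : Skeleton.alpha D < 1 / 5 := by
    rw [hαval, div_lt_iff₀ (by positivity)]
    have h9 : Skeleton.ell D ≤ Skeleton.ell D ^ 9 := le_self_pow₀ (by linarith) (by norm_num)
    nlinarith [Real.pi_lt_four]
  have hℓinv : (Skeleton.ell D)⁻¹ ≤ 1 / 21 := by
    rw [inv_eq_one_div, div_le_div_iff₀ hℓpos (by norm_num)]; linarith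
  have hℓinv0 : 0 < (Skeleton.ell D)⁻¹ := inv_pos.mpr hℓpos
  -- the abscissae of the contour
  set a₀ : ℝ := 1 - (Skeleton.ell D)⁻¹ with ha₀
  set b₀ : ℝ := 1 + Skeleton.alpha D with hb₀
  have ha₀19 : 19 / 20 < a₀ := by rw [ha₀]; linarith
  have hab : a₀ < b₀ := by rw [ha₀, hb₀]; linarith
  have hb₀32 : b₀ ≤ 3 / 2 := by rw [hb₀]; linarith
  have hb₀1 : 1 < b₀ := by rw [hb₀]; linarith
  have hDD : -(D : ℝ) < D := by linarith
  have hDD' : -(D : ℝ) ≤ D := hDD.le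
  -- the shifts
  obtain ⟨hβ1, hβ2, hβ3⟩ := beta_eq_b_mul_I c' D
  obtain ⟨hre1, hre2, hre3⟩ := beta_re c' D
  have hb3lt : Skeleton.b3 c' D < 1 := by
    have ht := (abs_le.mp hcαℓ)
    have : Skeleton.b3 c' D = 3 * Skeleton.alpha D * (1 - c' * Skeleton.alpha D * Skeleton.ell D) := rfl
    nlinarith
  have hbne : Skeleton.b1 c' D ≠ 0 ∧ Skeleton.b2 c' D ≠ 0 ∧ Skeleton.b3 c' D ≠ 0 :=
    ⟨hb1pos.ne', by linarith, by linarith⟩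
  have hβne1 : Skeleton.beta1 c' D ≠ 0 := by
    rw [hβ1]; exact mul_ne_zero (Complex.ofReal_ne_zero.mpr hbne.1) Complex.I_ne_zero
  have hβne2 : Skeleton.beta2 c' D ≠ 0 := by
    rw [hβ2]; exact mul_ne_zero (Complex.ofReal_ne_zero.mpr hbne.2.1) Complex.I_ne_zero
  have hβne3 : Skeleton.beta3 c' D ≠ 0 := by
    rw [hβ3]; exact mul_ne_zero (Complex.ofReal_ne_zero.mpr hbne.2.2) Complex.I_ne_zero
  have hβ12 : Skeleton.beta1 c' D ≠ Skeleton.beta2 c' D := by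
    rw [hβ1, hβ2]; intro h
    have := mul_right_cancel₀ Complex.I_ne_zero h
    exact hb12.ne (by exact_mod_cast this)
  have hβ23 : Skeleton.beta2 c' D ≠ Skeleton.beta3 c' D := by
    rw [hβ2, hβ3]; intro h
    have := mul_right_cancel₀ Complex.I_ne_zero h
    exact hb23.ne (by exact_mod_cast this)
  have hβ13 : Skeleton.beta1 c' D ≠ Skeleton.beta3 c' D := by
    rw [hβ1, hβ3]; intro h
    have := mul_right_cancel₀ Complex.I_ne_zero h
    exact (hb12.trans hb23).ne (by exact_mod_cast this)
  /- 2. the point `x = l₂/(pk)` and the two integrands -/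
  have hp0 : 0 < p := by
    simp only [Skeleton.primeWindow, Finset.mem_filter] at hp
    exact hp.2.pos
  set x : ℝ := (l₂ : ℝ) / ((p : ℝ) * k) with hxdef
  have hx : 0 < x := by
    have : (0 : ℝ) < p := Nat.cast_pos.mpr hp0
    have : (0 : ℝ) < k := Nat.cast_pos.mpr hk
    have : (0 : ℝ) < l₂ := Nat.cast_pos.mpr hl₂
    positivity
  have hd₁' : d₁ ≠ 0 := hd₁.ne'
  set Fr : ℂ → ℂ := fun s => (x : ℂ) ^ (-s) *
        (Skeleton.kappaTilde c' D d₁ (d₂ * k) s * Skeleton.lam c' D (d₁ * d₂ * k) s *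
          (riemannZeta (s + Skeleton.beta1 c' D) * riemannZeta (s + Skeleton.beta2 c' D) *
            riemannZeta (s + Skeleton.beta3 c' D) *
            Function.update (fun z : ℂ => (riemannZeta z)⁻¹) 1 0 s * Skeleton.deltaW D s)) with hFr0
  have hFr : ∀ s : ℂ, Fr s = (x : ℂ) ^ (-s) *
        (Skeleton.kappaTilde c' D d₁ (d₂ * k) s * Skeleton.lam c' D (d₁ * d₂ * k) s *
          (riemannZeta (s + Skeleton.beta1 c' D) * riemannZeta (s + Skeleton.beta2 c' D) *
            riemannZeta (s + Skeleton.beta3 c' D) *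
            Function.update (fun z : ℂ => (riemannZeta z)⁻¹) 1 0 s * Skeleton.deltaW D s)) :=
    fun s => by rw [hFr0]
  set F : ℂ → ℂ := fun s => (x : ℂ) ^ (-s) *
    (Skeleton.kappaTilde c' D d₁ (d₂ * k) s * Skeleton.lam c' D (d₁ * d₂ * k) s * resFn c' D s)
    with hF0
  have hFpt : ∀ u t : ℝ, u ≠ 1 ∨ t ≠ 0 → F ((u : ℂ) + t * I) = Fr ((u : ℂ) + t * I) := by
    intro u t hut
    have hne : (u : ℂ) + t * I ≠ 1 := by
      intro h
      have hre := congrArg Complex.re h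
      have him := congrArg Complex.im h
      simp at hre him
      rcases hut with hu | ht
      · exact hu hre
      · exact ht him
    rw [integrand_eq_of_ne_one hFr hne]
  /- 3. holomorphy on `U ∖ S` and on the strip -/
  set U : Set ℂ := {z : ℂ | 19 / 20 < z.re ∧ (z = 1 ∨ riemannZeta z ≠ 0)} with hU
  have hUopen : IsOpen U := isOpen_goodSet
  have hdiffAt : ∀ z ∈ U, z ≠ 1 - Skeleton.beta1 c' D → z ≠ 1 - Skeleton.beta2 c' D →
      z ≠ 1 - Skeleton.beta3 c' D → DifferentiableAt ℂ Fr z := by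
    intro z hz h1 h2 h3
    refine differentiableAt_integrand hFr hD3 hd₁' hx hz ?_ ?_ ?_
    · exact fun h => h1 (by rw [← h]; ring)
    · exact fun h => h2 (by rw [← h]; ring)
    · exact fun h => h3 (by rw [← h]; ring)
  have hmemU_of_re : ∀ z : ℂ, 1 < z.re → z ∈ U := fun z hz =>
    ⟨by linarith, Or.inr (riemannZeta_ne_zero_of_one_lt_re hz)⟩
  have hne_pole_of_re : ∀ z : ℂ, z.re ≠ 1 → ∀ β : ℂ, β.re = 0 → z ≠ 1 - β := by
    intro z hz β hβ h
    apply hz; rw [h, Complex.sub_re, Complex.one_re, hβ, sub_zero]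
  have hFstrip : DifferentiableOn ℂ Fr (Complex.re ⁻¹' Icc b₀ (3 / 2)) := by
    intro z hz
    have hz1 : 1 < z.re := lt_of_lt_of_le hb₀1 hz.1
    exact (hdiffAt z (hmemU_of_re z hz1) (hne_pole_of_re z hz1.ne' _ hre1)
      (hne_pole_of_re z hz1.ne' _ hre2) (hne_pole_of_re z hz1.ne' _ hre3)).differentiableWithinAt
  /- 4. the vertical shift `3/2 → 1 + α` -/
  have hint_b : Integrable fun t : ℝ => Fr ((b₀ : ℂ) + t * I) :=
    integrable_integrand_line hFr hD3 hα hd₁' hx le_rfl hb₀32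
  have hint_c : Integrable fun t : ℝ => Fr (((3 / 2 : ℝ) : ℂ) + t * I) :=
    integrable_integrand_line hFr hD3 hα hd₁' hx hb₀32 le_rfl
  have hshift := Literature.Analysis.Complex.integral_vertical_eq_of_differentiableOn hb₀32 hFstrip
    hint_b hint_c (decay_integrand hFr hD3 hα hd₁' hx)
  /- 5. the rectangle `[a₀, b₀] × [−D, D]` with the three poles -/
  set p₁ : ℂ := 1 - Skeleton.beta1 c' D with hp₁
  set p₂ : ℂ := 1 - Skeleton.beta2 c' D with hp₂
  set p₃ : ℂ := 1 - Skeleton.beta3 c' D with hp₃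
  have hp12 : p₁ ≠ p₂ := fun h => hβ12 (by rw [hp₁, hp₂] at h; linear_combination -h)
  have hp13 : p₁ ≠ p₃ := fun h => hβ13 (by rw [hp₁, hp₃] at h; linear_combination -h)
  have hp23 : p₂ ≠ p₃ := fun h => hβ23 (by rw [hp₂, hp₃] at h; linear_combination -h)
  have hpre : p₁.re = 1 ∧ p₂.re = 1 ∧ p₃.re = 1 := by
    refine ⟨?_, ?_, ?_⟩ <;> simp [hp₁, hp₂, hp₃, hre1, hre2, hre3]
  have hpim : p₁.im = -Skeleton.b1 c' D ∧ p₂.im = -Skeleton.b2 c' D ∧ p₃.im = -Skeleton.b3 c' D := by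
    refine ⟨?_, ?_, ?_⟩
    · rw [hp₁, hβ1]; simp
    · rw [hp₂, hβ2]; simp
    · rw [hp₃, hβ3]; simp
  -- residue values
  set R₁ : ℂ := (x : ℂ) ^ (-(1 - Skeleton.beta1 c' D)) *
          (Skeleton.kappaTilde c' D d₁ (d₂ * k) (1 - Skeleton.beta1 c' D) *
            Skeleton.lam c' D (d₁ * d₂ * k) (1 - Skeleton.beta1 c' D) *
            (riemannZeta (1 - Skeleton.beta1 c' D + Skeleton.beta2 c' D) *
              riemannZeta (1 - Skeleton.beta1 c' D + Skeleton.beta3 c' D) *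
              Function.update (fun z : ℂ => (riemannZeta z)⁻¹) 1 0 (1 - Skeleton.beta1 c' D) *
              Skeleton.deltaW D (1 - Skeleton.beta1 c' D))) with hR₁
  set R₂ : ℂ := (x : ℂ) ^ (-(1 - Skeleton.beta2 c' D)) *
          (Skeleton.kappaTilde c' D d₁ (d₂ * k) (1 - Skeleton.beta2 c' D) *
            Skeleton.lam c' D (d₁ * d₂ * k) (1 - Skeleton.beta2 c' D) *
            (riemannZeta (1 - Skeleton.beta2 c' D + Skeleton.beta1 c' D) *
              riemannZeta (1 - Skeleton.beta2 c' D + Skeleton.beta3 c' D) *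
              Function.update (fun z : ℂ => (riemannZeta z)⁻¹) 1 0 (1 - Skeleton.beta2 c' D) *
              Skeleton.deltaW D (1 - Skeleton.beta2 c' D))) with hR₂
  set R₃ : ℂ := (x : ℂ) ^ (-(1 - Skeleton.beta3 c' D)) *
          (Skeleton.kappaTilde c' D d₁ (d₂ * k) (1 - Skeleton.beta3 c' D) *
            Skeleton.lam c' D (d₁ * d₂ * k) (1 - Skeleton.beta3 c' D) *
            (riemannZeta (1 - Skeleton.beta3 c' D + Skeleton.beta1 c' D) *
              riemannZeta (1 - Skeleton.beta3 c' D + Skeleton.beta2 c' D) *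
              Function.update (fun z : ℂ => (riemannZeta z)⁻¹) 1 0 (1 - Skeleton.beta3 c' D) *
              Skeleton.deltaW D (1 - Skeleton.beta3 c' D))) with hR₃
  set r : ℂ → ℂ := fun q => if q = p₁ then R₁ else if q = p₂ then R₂ else R₃ with hr
  have hr1 : r p₁ = R₁ := by simp only [hr, if_pos rfl]
  have hr2 : r p₂ = R₂ := by simp only [hr, if_neg hp12.symm, if_true]
  have hr3 : r p₃ = R₃ := by simp only [hr, if_neg hp13.symm, if_neg hp23.symm]
  set S : Finset ℂ := {p₁, p₂, p₃} with hS
  have hsumS : ∑ q ∈ S, r q = R₁ + R₂ + R₃ := by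
    rw [hS, Finset.sum_insert (by simp [hp12, hp13]), Finset.sum_insert (by simp [hp23]),
      Finset.sum_singleton, hr1, hr2, hr3, add_assoc]
  -- the rectangle is inside `U`; the poles are inside the open rectangle
  have hKU : Icc a₀ b₀ ×ℂ Icc (-(D : ℝ)) D ⊆ U := by
    intro z hz
    rw [Complex.mem_reProdIm] at hz
    refine ⟨lt_of_lt_of_le ha₀19 hz.1.1, Or.inr (hZfree D χ hD₁ hq hprim hA z ?_ ?_)⟩
    · rw [ha₀] at hz; exact hz.1.1
    · exact abs_le.mpr hz.2
  have hSsub : ((S : Set ℂ)) ⊆ Ioo a₀ b₀ ×ℂ Ioo (-(D : ℝ)) D := by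
    intro q hq'
    rw [hS, Finset.coe_insert, Finset.coe_insert, Finset.coe_singleton] at hq'
    rw [Complex.mem_reProdIm]
    have hD1 : (1 : ℝ) ≤ D := by exact_mod_cast (show 1 ≤ D by omega)
    have key : ∀ q : ℂ, q.re = 1 → (∃ b : ℝ, q.im = -b ∧ 0 < b ∧ b < 1) →
        q.re ∈ Ioo a₀ b₀ ∧ q.im ∈ Ioo (-(D : ℝ)) D := by
      rintro q hqre ⟨b, hqim, hb0, hb1⟩
      refine ⟨⟨by rw [hqre, ha₀]; linarith, by rw [hqre, hb₀]; linarith⟩, ?_, ?_⟩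
      · rw [hqim]; linarith
      · rw [hqim]; linarith
    rcases hq' with rfl | rfl | rfl
    · exact key _ hpre.1 ⟨_, hpim.1, hb1pos, by linarith⟩
    · exact key _ hpre.2.1 ⟨_, hpim.2.1, by linarith, by linarith⟩
    · exact key _ hpre.2.2 ⟨_, hpim.2.2, by linarith, hb3lt⟩
  have hFdiff : DifferentiableOn ℂ Fr (U \ (S : Set ℂ)) := by
    intro z hz
    have hzS : z ∉ (S : Set ℂ) := hz.2
    rw [hS, Finset.coe_insert, Finset.coe_insert, Finset.coe_singleton] at hzS
    simp only [Set.mem_insert_iff, Set.mem_singleton_iff, not_or] at hzS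
    exact (hdiffAt z hz.1 hzS.1 hzS.2.1 hzS.2.2).differentiableWithinAt
  -- the simple-pole structure at each `p_j`
  obtain ⟨ε, hε, hηd, -⟩ := exists_ball_eta_differentiableOn
  have hpU : ∀ q : ℂ, q.re = 1 → q ∈ U := fun q hq =>
    ⟨by rw [hq]; norm_num, Or.inr (riemannZeta_ne_zero_of_one_le_re (by rw [hq]))⟩
  have hVη : ∀ β : ℂ, DifferentiableOn ℂ
      (fun z : ℂ => Function.update (fun s : ℂ => (s - 1) * riemannZeta s) 1 1 (z + β))
      ((fun z : ℂ => z + β) ⁻¹' Metric.ball 1 ε) := fun β =>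
    hηd.comp ((differentiable_id.add_const β).differentiableOn) fun z hz => hz
  have hVopen : ∀ β : ℂ, IsOpen ((fun z : ℂ => z + β) ⁻¹' Metric.ball (1 : ℂ) ε) := fun β =>
    Metric.isOpen_ball.preimage (continuous_id.add continuous_const)
  have hne_open : ∀ β : ℂ, IsOpen {z : ℂ | z + β ≠ 1} := fun β =>
    isOpen_ne_fun (continuous_id.add continuous_const) continuous_const
  have hpole : ∀ q ∈ S, ∃ φ : ℂ → ℂ, ∃ V ∈ 𝓝 q, DifferentiableOn ℂ φ V ∧ φ q = r q ∧
      ∀ z ∈ V, z ≠ q → Fr z = φ z / (z - q) := by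
    intro q hq'
    rw [hS, Finset.mem_insert, Finset.mem_insert, Finset.mem_singleton] at hq'
    rcases hq' with rfl | rfl | rfl
    · -- pole at `1 − β₁`
      set V : Set ℂ := U ∩ {z : ℂ | z + Skeleton.beta2 c' D ≠ 1} ∩ {z : ℂ | z + Skeleton.beta3 c' D ≠ 1} ∩
        ((fun z : ℂ => z + Skeleton.beta1 c' D) ⁻¹' Metric.ball 1 ε) with hV
      have hVo : IsOpen V := ((hUopen.inter (hne_open _)).inter (hne_open _)).inter (hVopen _)
      have hpV : p₁ ∈ V := by
        refine ⟨⟨⟨hpU _ hpre.1, ?_⟩, ?_⟩, ?_⟩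
        · show p₁ + Skeleton.beta2 c' D ≠ 1
          rw [hp₁]; intro h; exact hβ12 (by linear_combination -h)
        · show p₁ + Skeleton.beta3 c' D ≠ 1
          rw [hp₁]; intro h; exact hβ13 (by linear_combination -h)
        · show p₁ + Skeleton.beta1 c' D ∈ Metric.ball (1 : ℂ) ε
          rw [hp₁, sub_add_cancel]; exact Metric.mem_ball_self hε
      obtain ⟨φ, V', hV', hφd, hφp, hφ⟩ := pole_one hFr hD3 hd₁' hx hVo hpV
        (fun z hz => hz.1.1.1) (fun z hz => hz.1.1.2) (fun z hz => hz.1.2)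
        ((hVη _).mono fun z hz => hz.2)
      exact ⟨φ, V', hV', hφd, by rw [hφp, hr1], hφ⟩
    · -- pole at `1 − β₂`
      set V : Set ℂ := U ∩ {z : ℂ | z + Skeleton.beta1 c' D ≠ 1} ∩ {z : ℂ | z + Skeleton.beta3 c' D ≠ 1} ∩
        ((fun z : ℂ => z + Skeleton.beta2 c' D) ⁻¹' Metric.ball 1 ε) with hV
      have hVo : IsOpen V := ((hUopen.inter (hne_open _)).inter (hne_open _)).inter (hVopen _)
      have hpV : p₂ ∈ V := by
        refine ⟨⟨⟨hpU _ hpre.2.1, ?_⟩, ?_⟩, ?_⟩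
        · show p₂ + Skeleton.beta1 c' D ≠ 1
          rw [hp₂]; intro h; exact hβ12 (by linear_combination h)
        · show p₂ + Skeleton.beta3 c' D ≠ 1
          rw [hp₂]; intro h; exact hβ23 (by linear_combination -h)
        · show p₂ + Skeleton.beta2 c' D ∈ Metric.ball (1 : ℂ) ε
          rw [hp₂, sub_add_cancel]; exact Metric.mem_ball_self hε
      obtain ⟨φ, V', hV', hφd, hφp, hφ⟩ := pole_two hFr hD3 hd₁' hx hVo hpV
        (fun z hz => hz.1.1.1) (fun z hz => hz.1.1.2) (fun z hz => hz.1.2)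
        ((hVη _).mono fun z hz => hz.2)
      exact ⟨φ, V', hV', hφd, by rw [hφp, hr2], hφ⟩
    · -- pole at `1 − β₃`
      set V : Set ℂ := U ∩ {z : ℂ | z + Skeleton.beta1 c' D ≠ 1} ∩ {z : ℂ | z + Skeleton.beta2 c' D ≠ 1} ∩
        ((fun z : ℂ => z + Skeleton.beta3 c' D) ⁻¹' Metric.ball 1 ε) with hV
      have hVo : IsOpen V := ((hUopen.inter (hne_open _)).inter (hne_open _)).inter (hVopen _)
      have hpV : p₃ ∈ V := by
        refine ⟨⟨⟨hpU _ hpre.2.2, ?_⟩, ?_⟩, ?_⟩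
        · show p₃ + Skeleton.beta1 c' D ≠ 1
          rw [hp₃]; intro h; exact hβ13 (by linear_combination h)
        · show p₃ + Skeleton.beta2 c' D ≠ 1
          rw [hp₃]; intro h; exact hβ23 (by linear_combination h)
        · show p₃ + Skeleton.beta3 c' D ∈ Metric.ball (1 : ℂ) ε
          rw [hp₃, sub_add_cancel]; exact Metric.mem_ball_self hε
      obtain ⟨φ, V', hV', hφd, hφp, hφ⟩ := pole_three hFr hD3 hd₁' hx hVo hpV
        (fun z hz => hz.1.1.1) (fun z hz => hz.1.1.2) (fun z hz => hz.1.2)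
        ((hVη _).mono fun z hz => hz.2)
      exact ⟨φ, V', hV', hφd, by rw [hφp, hr3], hφ⟩
  have hrect := Literature.Analysis.Complex.rectBoundaryIntegral_eq_sum_of_simplePoles hab hDD S Fr r U
    hUopen hKU hSsub hFdiff hpole
  rw [Literature.Analysis.Complex.rectBoundaryIntegral, hsumS,
    residue_sum_eq c' D d₁ (d₂ * k) (d₁ * d₂ * k) x hβne1 hβne2 hβne3] at hrect
  /- 6. splitting the line `σ = 1 + α` at `±D` -/
  have hsplit : ∫ t : ℝ, Fr ((b₀ : ℂ) + t * I) =
      (∫ t in Iic (-(D : ℝ)), Fr ((b₀ : ℂ) + t * I)) +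
        ((∫ t in (-(D : ℝ))..D, Fr ((b₀ : ℂ) + t * I)) + ∫ t in Ioi (D : ℝ), Fr ((b₀ : ℂ) + t * I)) := by
    rw [← intervalIntegral.integral_Iic_add_Ioi hint_b.integrableOn hint_b.integrableOn,
      ← Set.Ioc_union_Ioi_eq_Ioi hDD', setIntegral_union Set.Ioc_disjoint_Ioi_same measurableSet_Ioi
        hint_b.integrableOn hint_b.integrableOn, intervalIntegral.integral_of_le hDD']
  /- 7. the two sides in terms of `Fr` -/
  have hLHS : mellinInv (3 / 2)
      (fun s => Skeleton.kappaTilde c' D d₁ (d₂ * k) s * Skeleton.lam c' D (d₁ * d₂ * k) s * resFn c' D s) x =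
      (((1 / (2 * π) : ℝ)) : ℂ) * ∫ t : ℝ, Fr (((3 / 2 : ℝ) : ℂ) + t * I) := by
    rw [mellinInv, Complex.real_smul]
    congr 1
    refine integral_congr_ae (Eventually.of_forall fun t => ?_)
    have hne : (((3 / 2 : ℝ) : ℂ) + t * I) ≠ 1 := by
      intro h; have := congrArg Complex.re h; simp at this; norm_num at this
    simp only [smul_eq_mul]
    rw [integrand_eq_of_ne_one hFr hne]
  have hV1 : (∫ t in Iic (-(D : ℝ)), F (1 + Skeleton.alpha D + t * I)) =
      ∫ t in Iic (-(D : ℝ)), Fr ((b₀ : ℂ) + t * I) := by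
    refine setIntegral_congr_fun measurableSet_Iic fun t _ => ?_
    rw [show (1 : ℂ) + Skeleton.alpha D + t * I = ((b₀ : ℝ) : ℂ) + t * I by rw [hb₀]; push_cast; ring]
    exact hFpt b₀ t (Or.inl hb₀1.ne')
  have hV2 : (∫ t in Ici (D : ℝ), F (1 + Skeleton.alpha D + t * I)) =
      ∫ t in Ioi (D : ℝ), Fr ((b₀ : ℂ) + t * I) := by
    rw [integral_Ici_eq_integral_Ioi]
    refine setIntegral_congr_fun measurableSet_Ioi fun t _ => ?_
    rw [show (1 : ℂ) + Skeleton.alpha D + t * I = ((b₀ : ℝ) : ℂ) + t * I by rw [hb₀]; push_cast; ring]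
    exact hFpt b₀ t (Or.inl hb₀1.ne')
  have hV3 : (∫ t in Icc (-(D : ℝ)) D, F (1 - (Skeleton.ell D)⁻¹ + t * I)) =
      ∫ t in (-(D : ℝ))..D, Fr ((a₀ : ℂ) + t * I) := by
    rw [integral_Icc_eq_integral_Ioc, ← intervalIntegral.integral_of_le hDD']
    refine intervalIntegral.integral_congr fun t _ => ?_
    rw [show (1 : ℂ) - (Skeleton.ell D)⁻¹ + t * I = ((a₀ : ℝ) : ℂ) + t * I by rw [ha₀]; push_cast; ring]
    exact hFpt a₀ t (Or.inl (by rw [ha₀]; linarith))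
  have hD0' : (D : ℝ) ≠ 0 := hDpos.ne'
  have hH1 : (∫ σ in (1 - (Skeleton.ell D)⁻¹)..(1 + Skeleton.alpha D), F (σ + D * I)) =
      ∫ σ in a₀..b₀, Fr ((σ : ℂ) + ((D : ℝ) : ℂ) * I) := by
    refine intervalIntegral.integral_congr fun σ _ => ?_
    rw [show (σ : ℂ) + (D : ℂ) * I = (σ : ℂ) + ((D : ℝ) : ℂ) * I by push_cast; ring]
    exact hFpt σ D (Or.inr hD0')
  have hH2 : (∫ σ in (1 - (Skeleton.ell D)⁻¹)..(1 + Skeleton.alpha D), F (σ - D * I)) =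
      ∫ σ in a₀..b₀, Fr ((σ : ℂ) + ((-(D : ℝ) : ℝ) : ℂ) * I) := by
    refine intervalIntegral.integral_congr fun σ _ => ?_
    rw [show (σ : ℂ) - (D : ℂ) * I = (σ : ℂ) + ((-(D : ℝ) : ℝ) : ℂ) * I by push_cast; ring]
    exact hFpt σ (-(D : ℝ)) (Or.inr (neg_ne_zero.mpr hD0'))
  /- 8. assemble -/
  rw [hLHS, ← hshift, hsplit, contour719, vert747, horiz748, hV1, hV2, hV3, hH1, hH2]
  have hI : (I : ℂ) ≠ 0 := Complex.I_ne_zero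
  have hπ : ((π : ℝ) : ℂ) ≠ 0 := Complex.ofReal_ne_zero.mpr Real.pi_pos.ne'
  -- the interval integral on `σ = b₀` from the rectangle identity
  have hmid : (∫ t in (-(D : ℝ))..D, Fr ((b₀ : ℂ) + t * I)) =
      (∫ t in (-(D : ℝ))..D, Fr ((a₀ : ℂ) + t * I)) -
        I * ((∫ σ in a₀..b₀, Fr ((σ : ℂ) + ((D : ℝ) : ℂ) * I)) -
          ∫ σ in a₀..b₀, Fr ((σ : ℂ) + ((-(D : ℝ) : ℝ) : ℂ) * I)) +
        2 * π * ∑ j ∈ Finset.Icc 1 3,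
          frakr c' D j * Skeleton.kappaTildeZero c' D j d₁ (d₂ * k) *
            Skeleton.lamZero c' D j (d₁ * d₂ * k) * (x : ℂ) ^ (-(1 - Skeleton.betaJ c' D j)) := by
    have h := hrect
    have hI2 : I * I = -1 := Complex.I_mul_I
    set Vm := ∫ t in (-(D : ℝ))..D, Fr ((b₀ : ℂ) + t * I) with hVm
    set W := ∫ t in (-(D : ℝ))..D, Fr ((a₀ : ℂ) + t * I) with hW
    set Ht := ∫ σ in a₀..b₀, Fr ((σ : ℂ) + ((D : ℝ) : ℂ) * I) with hHt
    set Hb := ∫ σ in a₀..b₀, Fr ((σ : ℂ) + ((-(D : ℝ) : ℝ) : ℂ) * I) with hHb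
    set Sr := ∑ j ∈ Finset.Icc 1 3,
          frakr c' D j * Skeleton.kappaTildeZero c' D j d₁ (d₂ * k) *
            Skeleton.lamZero c' D j (d₁ * d₂ * k) * (x : ℂ) ^ (-(1 - Skeleton.betaJ c' D j)) with hSr
    linear_combination (-I) * h + (Vm - W - 2 * π * Sr) * hI2
  rw [hmid]
  push_cast
  field_simp
  ring_nf
  rw [Complex.I_sq]
  ring

variable (c' : ℝ) in
/-- `Step7u047` — `_holds` alias of `step7u047_holds` above under the fact's exact name, stated under the
prover's own binders as section variables (appended 2026-08-28, D-0026 bookkeeping: the proof term is the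
existing theorem of this file; no statement, definition or attribute is edited; no new named fact; the
ledger's debt table listed the fact unproved). [cite: Zhang2022LandauSiegel, §7 p.40, tex L2108–L2117] -/
theorem _root_.Literature.NumberTheory.LFunctions.Zhang2022.Section7dStatements.Step7u047_holds :
    _root_.Literature.NumberTheory.LFunctions.Zhang2022.Section7dStatements.Step7u047 c' :=
  _root_.Literature.NumberTheory.LFunctions.Zhang2022.Section7dStatements.step7u047_holds (c' := c')

end Main

end Literature.NumberTheory.LFunctions.Zhang2022.Section7dStatements

end
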